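import Literature.Analysis.FluidPDE.PalasekObukhovBlowupProof
import Literature.Analysis.FluidPDE.PalasekObukhovParams

/-!
# Palasek 2026, §3: the blow-up tower with its printed constants, in tower coordinates

S. Palasek, *Finite-time blow-up in an elementary model of the 3D Navier–Stokes equations*,
arXiv:2605.13827 (2026), §3 (pp. 8–11) [Palasek2026ElementaryModel]. The proof of Theorem 1.3 is in
the tree (`PalasekObukhovBlowupProof.lean`, `Palasek2026_viscousBlowup_holds`), but its quantitative
content — the ENVELOPE of the constructed solution — is stated there only relative to the abstract
parameter bundle `BarrierHypotheses A δ μ0 c` and is not visible in the existence statement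
`Palasek2026_viscousBlowup`. This file packages, in the tower coordinates of
`PalasekObukhovParams.lean` (`scale N₀ b k = N_k = N₀^{b^k}`, `amp N₀ b β k = A_k = N_k^β`,
`delta N₀ b α k = δ_k`, `horizon N₀ b β c = T = c/A₀`, `tAct N₀ b β c k = t_k = -c/A_{k-2}`), the
solution of §3.3 together with every printed constant:

* `IsTowerSolution ν α N₀ b β c x` (a `Prop`-valued structure): `x_k(0) = A_k`; the cut-off forced
  system (x_system_nondimensionalized) `x_k' = -ρ_k(t)νN_k²x_k + x_{k-1}x_k - δ_kx_{k+1}²` on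
  `[-T, 0]`, i.e. force `g_k = (1-ρ_k)νN_k²x_k`; `C^∞` modes; and the envelope (sol_bounds)
  `A₀ ≤ x₀ ≤ 2A₀`, `0 ≤ x_k(t) ≤ 2A_k exp(½A_{k-1} max{t, t_k})`, with the trapping floors of
  Lemma 3.2 inherited by the solution, `x_k ≥ ¾A_k` on `[t_{k+1}, 0]` (eta_quarter_bound) and
  `x_k ≥ A_k exp(-5A_{k-1}/A_{k-2})` (eta_global_bound).
* `barrierHypotheses_amp`, `exists_isTowerSolution`: for `ν ≥ 0`, `1 < b`, `2b < β < α`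
  ((viscous_A_assumptions)) there is `N_* > 1` such that every base `N₀ ≥ N_*` carries the standing
  inequalities of §3.1 and a tower solution with `c = 1/10` — the composition of the tree theorems
  `barrierHypotheses_exp` ((exp_small)/(ratios)) and `exists_regular_solution` (Prop. 3.4 + limit).
* the readings of the envelope that the PDE-side bookkeeping quotes from Lemma 3.2 (dot-lemmas on
  `IsTowerSolution`): `host_pump` (`x_k ∈ [¾A_k, 2A_k]` throughout the activation window
  `[t_{k+1}, 0]` of the next level), `frozen` (`x_k(t) ≤ 2A_k e^{-(c/2)A_{k-1}/A_{k-2}}` for `t ≤ t_k`),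
  `log_div_le` (e-fold budget `log(A_k/x_k(t)) ≤ 5A_{k-1}/A_{k-2}`), `le_two_mul_amp`, `pos`,
  `forceTerm_le_smallFactor` (`0 ≤ g_k ≤ νN_k²·2A_k·e^{-(c/4)A_{k-1}/A_{k-2}}`, `g_k ≡ 0` on `[t_k/2, 0]`);
* the SCOPE of the standing inequalities read backwards exactly (`twelve_mul_delta_mul_amp_sq_le_iff`,
  `eight_mul_delta_mul_amp_sq_le_iff`, `exp_visc_mul_blowupT_le_iff`, `visc_absorption_iff`: (V2)/(S2)/(V1)
  and `νN_{k+1}² ≤ ¼A_k` as `N₀^{2(α-β)(b-1)} ≥ 12`, `N_k^{2(α-β)(b-1)} ≥ 16`, `νcN₀^{2-β} ≤ log(3/2)`,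
  `4ν ≤ N_k^{β-2b}`) and the existence theorem with the bundle as an explicit hypothesis,
  `isTowerSolution_of_barrierHypotheses`;
* the schedule identities `A_{k+1}/A_k = N_k^{β(b-1)}` and `A_{k-1}|t_k| = cA_{k-1}/A_{k-2}` (window in
  host turnovers), and the truncated ENERGY IDENTITY of the proofs of Prop. 3.3 / 3.4
  (`e_K' = -Σ_{k≤K} ρ_kνN_k^{2-2α}x_k²`, by the telescoping `δ_kN_k^{-2α} = N_{k+1}^{-2α}`), which the
  tree's trapping argument did not need and therefore did not record.

Everything is PROVED from the two imports; there are no new named facts and no new analysis. What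
is deliberately NOT here: the blow-up / regularity / force-vanishing conclusions of Theorem 1.3 and
Remark 1.4 (they are `Palasek2026_viscousBlowup_holds`), the barriers themselves (`zetaF`, `etaF` and
Lemma 3.2 for them live in `PalasekObukhovBlowupProof`), and anything about Navier–Stokes (§2/§4 of
the source are a dictionary and a discussion; see `PalasekObukhov/ShellEmbedding.lean`).
-/

open Set Filter
open scoped Topology ContDiff

noncomputable section

namespace Literature.Analysis.FluidPDE

namespace PalasekObukhov

/-! ### The schedule of §3.1 in tower coordinates -/

section Schedule

variable {N₀ b β α c : ℝ}

/-- `T = c/A₀`: the abstract lifespan `blowupT` at `A = amp N₀ b β` is `horizon`. [cite: Palasek2026ElementaryModel, §3.1 (tk_times_def)] -/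
theorem blowupT_amp (N₀ b β c : ℝ) : blowupT (amp N₀ b β) c = horizon N₀ b β c := rfl

/-- `t_k = -c/A_{k-2}`: the abstract activation times `tk` at `A = amp N₀ b β` are `tAct`. [cite: Palasek2026ElementaryModel, §3.1 (tk_times_def)] -/
theorem tk_amp (N₀ b β c : ℝ) : tk (amp N₀ b β) c = tAct N₀ b β c := rfl

/-- **(ratios) in power form: `A_{k+1}/A_k = N_k^{β(b-1)}`** — the growth factor from the host
amplitude `A_k` to the next one is a fixed power of the host frequency, hence `→ ∞` along the tower
("these statements make essential use of the fact that `(N_k)` grows faster than exponentially,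
since otherwise `A_{k+1}/A_k` would be bounded"). [cite: Palasek2026ElementaryModel, §3.1 (ratios) p. 8] -/
theorem amp_succ_div_eq_rpow (hN₀ : 0 < N₀) (b β : ℝ) (k : ℕ) :
    amp N₀ b β (k + 1) / amp N₀ b β k = scale N₀ b k ^ (β * (b - 1)) := by
  rw [amp_succ_div hN₀, scale_eq_exp hN₀, ← Real.exp_mul]
  congr 1
  ring

/-- `log(A_{k+1}/A_k) = β(b-1) log N_k`: the number of e-folds separating consecutive amplitudes.
[cite: Palasek2026ElementaryModel, §3.1 (ratios) p. 8] -/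
theorem log_amp_succ_div (hN₀ : 0 < N₀) (b β : ℝ) (k : ℕ) :
    Real.log (amp N₀ b β (k + 1) / amp N₀ b β k) = β * (b - 1) * Real.log (scale N₀ b k) := by
  rw [amp_succ_div hN₀, Real.log_exp, scale_eq_exp hN₀, Real.log_exp]
  ring

/-- **The activation window in host turnovers**: `A_{k-1}·|t_k| = c·A_{k-1}/A_{k-2}` (the window
`[t_k, 0]` on which `ζ_k` is driven at rate `½A_{k-1}` has length `|t_k| = c/A_{k-2}`).
[cite: Palasek2026ElementaryModel, §3.1 (tk_times_def) and Def. 3.1] -/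
theorem amp_mul_neg_tAct (N₀ b β c : ℝ) (k : ℕ) :
    amp N₀ b β (k - 1) * -tAct N₀ b β c k = c * (amp N₀ b β (k - 1) / amp N₀ b β (k - 2)) := by
  simp only [tAct, neg_neg]
  ring

/-- For `k ≥ 3` the window in host turnovers is the power `c·N_{k-2}^{β(b-1)}` of the frequency two
levels down. [cite: Palasek2026ElementaryModel, §3.1 (tk_times_def), (ratios)] -/
theorem amp_mul_neg_tAct_eq_rpow (hN₀ : 0 < N₀) (b β c : ℝ) {k : ℕ} (hk : 3 ≤ k) :
    amp N₀ b β (k - 1) * -tAct N₀ b β c k = c * scale N₀ b (k - 2) ^ (β * (b - 1)) := by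
  rw [amp_mul_neg_tAct, ← amp_succ_div_eq_rpow hN₀]
  have h : k - 2 + 1 = k - 1 := by omega
  rw [h]

/-- `½A_{k-1}t_k = -(c/2)·A_{k-1}/A_{k-2}`: the exponent of the frozen value `ζ_k(t_k)`.
[cite: Palasek2026ElementaryModel, §3.1 Lemma 3.2 (z_bound)] -/
theorem amp_div_two_mul_tAct (N₀ b β c : ℝ) (k : ℕ) :
    amp N₀ b β (k - 1) / 2 * tAct N₀ b β c k = -(c / 2 * (amp N₀ b β (k - 1) / amp N₀ b β (k - 2))) := by
  simp only [tAct]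
  ring

/-- `½A_{k-1}·(t_k/2) = -(c/4)·A_{k-1}/A_{k-2}`: the exponent of the small factor `θ_k` carried by the
force. [cite: Palasek2026ElementaryModel, §3.3 proof of Thm 1.3 (first display)] -/
theorem amp_div_two_mul_half_tAct (N₀ b β c : ℝ) (k : ℕ) :
    amp N₀ b β (k - 1) / 2 * (tAct N₀ b β c k / 2) =
      -(c / 4 * (amp N₀ b β (k - 1) / amp N₀ b β (k - 2))) := by
  simp only [tAct]
  ring

/-- The small factor of the tree at `A = amp`: `θ_k = exp(-(c/4)A_{k-1}/A_{k-2})`. [cite: Palasek2026ElementaryModel, §3.3 proof of Thm 1.3] -/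
theorem smallFactor_amp (N₀ b β c : ℝ) (k : ℕ) :
    smallFactor (amp N₀ b β) c k = Real.exp (-(c / 4 * (amp N₀ b β (k - 1) / amp N₀ b β (k - 2)))) :=
  rfl

/-- **The telescoping relation `δ_k N_k^{-2α} = N_{k+1}^{-2α}`** used in the energy identities of
Prop. 3.3 / 3.4. [cite: Palasek2026ElementaryModel, §3.2 proof of Prop. 3.3 ("the recurrence relation")] -/
theorem delta_mul_scale_rpow_neg (hN₀ : 0 < N₀) (b α : ℝ) (k : ℕ) :
    delta N₀ b α k * scale N₀ b k ^ (-(2 * α)) = scale N₀ b (k + 1) ^ (-(2 * α)) := by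
  have h0 := scale_pos hN₀ b k
  have h1 := scale_pos hN₀ b (k + 1)
  rw [delta, Real.div_rpow h0.le h1.le, Real.rpow_neg h0.le, Real.rpow_neg h1.le]
  have h2 : scale N₀ b k ^ (2 * α) ≠ 0 := (Real.rpow_pos_of_pos h0 _).ne'
  have h3 : scale N₀ b (k + 1) ^ (2 * α) ≠ 0 := (Real.rpow_pos_of_pos h1 _).ne'
  field_simp

/-- **The cut-off `ρ_k ≡ 1` on `[t_k/2, 0]`** (indeed on `t ≥ t_k/2`): the dissipation of mode `k ≥ 1`
is fully on during the second half of its activation window. [cite: Palasek2026ElementaryModel, §3.3 (rho_k_properties)] -/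
theorem modeCutoff_amp_eq_one (hN₀ : 0 < N₀) (hc : 0 < c) {k : ℕ} (hk : 1 ≤ k) {t : ℝ}
    (ht : tAct N₀ b β c k / 2 ≤ t) : modeCutoff (amp N₀ b β) c k t = 1 := by
  rw [modeCutoff_of_pos hk]
  apply Real.smoothTransition.one_of_one_le
  have hA := amp_pos hN₀ b β (k - 2)
  have hslope : 0 ≤ cutoffSlope (amp N₀ b β) c k := by
    unfold cutoffSlope
    positivity
  have h1 : cutoffSlope (amp N₀ b β) c k * (tAct N₀ b β c k / 2) = -1 := by
    simp only [cutoffSlope, tAct]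
    field_simp
  have h2 := mul_le_mul_of_nonneg_left ht hslope
  linarith

/-- Hence the force `g_k = (1-ρ_k)νN_k²x_k` of mode `k ≥ 1` vanishes on `[t_k/2, 0]` ("`1 - ρ_k` is
supported in `(-∞, t_k/2]`"), whatever the amplitudes `x`. [cite: Palasek2026ElementaryModel, §3.3 proof of Thm 1.3] -/
theorem forceTerm_amp_eq_zero (hN₀ : 0 < N₀) (hc : 0 < c) (ν : ℝ) (x : ℝ → ℕ → ℝ) {k : ℕ}
    (hk : 1 ≤ k) {t : ℝ} (ht : tAct N₀ b β c k / 2 ≤ t) :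
    forceTerm ν (scale N₀ b) (amp N₀ b β) c x k t = 0 := by
  rw [forceTerm, viscCoeff, modeCutoff_amp_eq_one hN₀ hc hk ht, mul_one, sub_self, zero_mul]

end Schedule

/-! ### The standing inequalities of §3.1 in tower coordinates -/

section Standing

variable {ν b β α : ℝ}

/-- **(exp_small), (ratios) and `β > 2b` for `N₀` large, in tower coordinates.** For `ν ≥ 0`,
`1 < b`, `2b < β < α` there is `N_* > 1` such that for every base `N₀ ≥ N_*` the schedule
`A_k = N_k^β`, `δ_k = (N_k/N_{k+1})^{2α}`, `μ₀ = νN₀²`, `c = 1/10` satisfies the tree's bundle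
`BarrierHypotheses` (the finitely many consequences of (exp_small)/(ratios) invoked in Lemma 3.2 and
Prop. 3.3), the viscous absorption `νN_k² ≤ ¼A_{k-1}` (`k ≥ 1`, from `β > 2b`), `δ_k ≤ 1`, and the
monotonicity of the ratios `A_{k+1}/A_k`. This is `barrierHypotheses_exp` read at `L = log N₀`.
[cite: Palasek2026ElementaryModel, §3.1 (exp_small), (ratios), (viscous_A_assumptions)] -/
theorem barrierHypotheses_amp (hν : 0 ≤ ν) (hb : 1 < b) (hβ : 2 * b < β) (hβα : β < α) :
    ∃ Nstar : ℝ, 1 < Nstar ∧ ∀ N₀ : ℝ, Nstar ≤ N₀ →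
      BarrierHypotheses (amp N₀ b β) (delta N₀ b α) (ν * N₀ ^ 2) (1 / 10) ∧
      (∀ k, 1 ≤ k → ν * scale N₀ b k ^ 2 ≤ amp N₀ b β (k - 1) / 4) ∧
      (∀ k, delta N₀ b α k ≤ 1) ∧
      (∀ k, amp N₀ b β (k + 1) / amp N₀ b β k ≤ amp N₀ b β (k + 2) / amp N₀ b β (k + 1)) := by
  obtain ⟨L₀, hL₀, hpar⟩ := barrierHypotheses_exp (α := α) hν hb hβ hβα
  refine ⟨Real.exp L₀, by simpa using hL₀, fun N₀ hN₀ => ?_⟩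
  have hN₀pos : 0 < N₀ := lt_of_lt_of_le (Real.exp_pos L₀) hN₀
  have hL : L₀ ≤ Real.log N₀ := (Real.le_log_iff_exp_le hN₀pos).2 hN₀
  obtain ⟨hH, hvisc, hδ1, hratio⟩ := hpar (Real.log N₀) hL
  have hA : expAmp b β (Real.log N₀) = amp N₀ b β := by
    funext k
    rw [amp_eq_exp hN₀pos]
    rfl
  have hδ : expDelta b α (Real.log N₀) = delta N₀ b α := by
    funext k
    simp only [expDelta, delta, Real.exp_log hN₀pos]
  have hs0 : scale N₀ b 0 = N₀ := by simp [scale]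
  rw [hA, hδ, Real.exp_log hN₀pos, hs0] at hH
  rw [hA, Real.exp_log hN₀pos] at hvisc
  rw [hδ] at hδ1
  rw [hA] at hratio
  exact ⟨hH, hvisc, hδ1, hratio⟩

end Standing

/-! ### The tower solution with its envelope -/

/-- **Palasek's blow-up tower in tower coordinates** (`N₀ > 1`, `b ≥ 1`, `β ≥ 0`, `c > 0` record the
sign conventions of §3.1 that make `A_k` increasing and `-T ≤ t_k ≤ 0`). A family of amplitudes
`x : [-T, 0] → ℝ^ℕ` (time first) is a tower solution when: `x_k(0) = A_k` (the blow-up profile is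
attained at `t = 0`); on `[-T, 0]`, `T = c/A₀`, it solves the cut-off viscous system
`x_k' = -ρ_k(t)νN_k²x_k + x_{k-1}x_k - δ_kx_{k+1}²` (`x_{-1} ≡ 0`), which is the rescaled forced Obukhov
system (x_system_nondimensionalized) with force `g_k = (1-ρ_k)νN_k²x_k` (`IsTowerSolution.hasDeriv_forced`);
every mode is `C^∞` in `t`; and the printed envelope holds: `A₀ ≤ x₀ ≤ 2A₀`,
`0 ≤ x_k(t) ≤ 2A_k exp(½A_{k-1}max{t, t_k})` for `k ≥ 1` ((sol_bounds) / (uniform_truncated_bounds_viscous)),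
and the floors the solution inherits from the trapping region `x_k ≥ η_k` and Lemma 3.2:
`x_k ≥ ¾A_k` on `[t_{k+1}, 0]` ((eta_quarter_bound)) and `x_k ≥ A_k exp(-5A_{k-1}/A_{k-2})` on
`[-T, 0]`, `k ≥ 2` ((eta_global_bound)). Here `N_k = scale N₀ b k`, `A_k = amp N₀ b β k`,
`δ_k = delta N₀ b α k`, `t_k = tAct N₀ b β c k`, `ρ_kνN_k² = viscCoeff ν (scale N₀ b) (amp N₀ b β) c k`.
[cite: Palasek2026ElementaryModel, §3.3 Prop. 3.4 and proof of Thm 1.3 (sol_bounds); §3.1 Lemma 3.2] -/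
structure IsTowerSolution (ν α N₀ b β c : ℝ) (x : ℝ → ℕ → ℝ) : Prop where
  /-- `N₀ > 1` -/
  one_lt_N₀ : 1 < N₀
  /-- `b ≥ 1` (the source has `b > 1`; only monotonicity of `A_k` is used by the envelope algebra) -/
  one_le_b : 1 ≤ b
  /-- `β ≥ 0` -/
  β_nonneg : 0 ≤ β
  /-- `c > 0` ("a small constant") -/
  c_pos : 0 < c
  /-- the blow-up profile `x_k(0) = A_k` -/
  terminal : ∀ k, x 0 k = amp N₀ b β k
  /-- the cut-off viscous system (truncated_viscous without truncation) on `[-T, 0]` -/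
  hasDeriv : ∀ k, ∀ t ∈ Icc (-horizon N₀ b β c) 0,
    HasDerivWithinAt (fun s => x s k)
      (truncRHS (delta N₀ b α) (viscCoeff ν (scale N₀ b) (amp N₀ b β) c) t (x t) k)
      (Icc (-horizon N₀ b β c) 0) t
  /-- every mode is smooth in time on `[-T, 0]` -/
  smooth : ∀ k, ContDiffOn ℝ ∞ (fun s => x s k) (Icc (-horizon N₀ b β c) 0)
  /-- (sol_bounds), mode `0`: `A₀ ≤ x₀ ≤ 2A₀` -/
  zero_bounds : ∀ t ∈ Icc (-horizon N₀ b β c) 0, amp N₀ b β 0 ≤ x t 0 ∧ x t 0 ≤ 2 * amp N₀ b β 0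
  /-- (sol_bounds), modes `k ≥ 1`: `0 ≤ x_k(t) ≤ 2A_k exp(½A_{k-1} max{t, t_k})` -/
  sol_bounds : ∀ k, 1 ≤ k → ∀ t ∈ Icc (-horizon N₀ b β c) 0,
    0 ≤ x t k ∧
      x t k ≤ 2 * amp N₀ b β k * Real.exp (amp N₀ b β (k - 1) / 2 * max t (tAct N₀ b β c k))
  /-- (eta_quarter_bound) inherited: `x_k ≥ ¾A_k` on `[t_{k+1}, 0]` -/
  quarter : ∀ k, 1 ≤ k → ∀ t ∈ Icc (tAct N₀ b β c (k + 1)) 0, 3 / 4 * amp N₀ b β k ≤ x t k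
  /-- (eta_global_bound) inherited: `x_k ≥ A_k exp(-5A_{k-1}/A_{k-2})` on `[-T, 0]`, `k ≥ 2` -/
  global : ∀ k, 2 ≤ k → ∀ t ∈ Icc (-horizon N₀ b β c) 0,
    amp N₀ b β k * Real.exp (-(5 * (amp N₀ b β (k - 1) / amp N₀ b β (k - 2)))) ≤ x t k

/-- **Existence of the tower (Palasek §3.3) for every large base.** For `ν ≥ 0`, `1 < b`,
`2b < β < α` there is `N_* > 1` such that for every `N₀ ≥ N_*` the schedule with `c = 1/10` carries a
tower solution: Prop. 3.4 for every truncation order, the `K → ∞` limit (p. 10) and the `C^∞`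
bootstrap, i.e. the tree's `exists_regular_solution` fed with `barrierHypotheses_amp`.
[cite: Palasek2026ElementaryModel, §3.3 Prop. 3.4 and proof of Thm 1.3; §3.1 (exp_small), (ratios)] -/
theorem exists_isTowerSolution {ν b β α : ℝ} (hν : 0 ≤ ν) (hb : 1 < b) (hβ : 2 * b < β)
    (hβα : β < α) :
    ∃ Nstar : ℝ, 1 < Nstar ∧ ∀ N₀ : ℝ, Nstar ≤ N₀ →
      ∃ x : ℝ → ℕ → ℝ, IsTowerSolution ν α N₀ b β (1 / 10) x := by
  obtain ⟨Nstar, hNstar, hpar⟩ := barrierHypotheses_amp (α := α) hν hb hβ hβα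
  refine ⟨Nstar, hNstar, fun N₀ hN₀ => ?_⟩
  obtain ⟨hH, hvisc, -, -⟩ := hpar N₀ hN₀
  have hN₀1 : 1 < N₀ := lt_of_lt_of_le hNstar hN₀
  have hs0 : scale N₀ b 0 = N₀ := by simp [scale]
  obtain ⟨x, h0, hode, hb0, hbd, h34, hglob, hsm⟩ :=
    exists_regular_solution (ν := ν) (N := scale N₀ b) (A := amp N₀ b β) (δ := delta N₀ b α)
      (μ0 := ν * N₀ ^ 2) (c := 1 / 10) hH hν (by rw [hs0]) hvisc
  exact ⟨x, hN₀1, hb.le, by linarith, by norm_num, h0, hode, hsm, hb0, hbd, h34, hglob⟩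

namespace IsTowerSolution

variable {ν α N₀ b β c : ℝ} {x : ℝ → ℕ → ℝ} (h : IsTowerSolution ν α N₀ b β c x)
include h

/-- `N₀ > 0`. [cite: Palasek2026ElementaryModel, §1.2 (nk_choice)] -/
theorem N₀_pos : 0 < N₀ := lt_trans one_pos h.one_lt_N₀

/-- `A_k > 0`. [cite: Palasek2026ElementaryModel, §3.1] -/
theorem amp_pos (k : ℕ) : 0 < amp N₀ b β k := PalasekObukhov.amp_pos h.N₀_pos b β k

/-- `T > 0`. [cite: Palasek2026ElementaryModel, §3.1 (tk_times_def)] -/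
theorem horizon_pos : 0 < horizon N₀ b β c := PalasekObukhov.horizon_pos h.N₀_pos h.c_pos b β

/-- `t_k ≤ 0`. [cite: Palasek2026ElementaryModel, §3.1 (tk_times_def)] -/
theorem tAct_le_zero (k : ℕ) : tAct N₀ b β c k ≤ 0 :=
  PalasekObukhov.tAct_le_zero h.N₀_pos h.c_pos.le b β k

/-- `-T ≤ t_k`. [cite: Palasek2026ElementaryModel, §3.1 (tk_times_def)] -/
theorem neg_horizon_le_tAct (k : ℕ) : -horizon N₀ b β c ≤ tAct N₀ b β c k :=
  PalasekObukhov.neg_horizon_le_tAct h.one_lt_N₀.le h.one_le_b h.β_nonneg h.c_pos.le k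

/-- The activation window `[t_k, 0]` lies inside `[-T, 0]`. [cite: Palasek2026ElementaryModel, §3.1 (tk_times_def)] -/
theorem Icc_tAct_subset (k : ℕ) : Icc (tAct N₀ b β c k) 0 ⊆ Icc (-horizon N₀ b β c) 0 :=
  Icc_subset_Icc_left (h.neg_horizon_le_tAct k)

/-- **The forced form of the system**: `x_k' = -νN_k²x_k + x_{k-1}x_k - δ_kx_{k+1}² + g_k(t)` with
`g_k = (1-ρ_k)νN_k²x_k` (`forceTerm`), i.e. (x_system_nondimensionalized) with `ν` carried along.
[cite: Palasek2026ElementaryModel, §3 (x_system_nondimensionalized); §3.3 proof of Thm 1.3 ("g_k(t) = (1-ρ_k(t))N_k²x_k")] -/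
theorem hasDeriv_forced (k : ℕ) {t : ℝ} (ht : t ∈ Icc (-horizon N₀ b β c) 0) :
    HasDerivWithinAt (fun s => x s k)
      (-(ν * scale N₀ b k ^ 2) * x t k + (if k = 0 then 0 else x t (k - 1) * x t k)
        - delta N₀ b α k * x t (k + 1) ^ 2 + forceTerm ν (scale N₀ b) (amp N₀ b β) c x k t)
      (Icc (-horizon N₀ b β c) 0) t := by
  have h1 := h.hasDeriv k t ht
  rw [truncRHS_viscCoeff_eq] at h1
  exact h1

/-- The modes are continuous on `[-T, 0]`. [cite: Palasek2026ElementaryModel, §3.3 Prop. 3.4] -/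
theorem continuousOn (k : ℕ) : ContinuousOn (fun s => x s k) (Icc (-horizon N₀ b β c) 0) :=
  (h.smooth k).continuousOn

/-- **Uniform ceiling `x_k ≤ 2A_k`** on `[-T, 0]`, every mode (the exponential in (sol_bounds) is `≤ 1`).
[cite: Palasek2026ElementaryModel, §3.3 (sol_bounds)] -/
theorem le_two_mul_amp (k : ℕ) {t : ℝ} (ht : t ∈ Icc (-horizon N₀ b β c) 0) :
    x t k ≤ 2 * amp N₀ b β k := by
  rcases Nat.eq_zero_or_pos k with rfl | hk
  · exact (h.zero_bounds t ht).2
  · have hb := (h.sol_bounds k hk t ht).2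
    have hexp : Real.exp (amp N₀ b β (k - 1) / 2 * max t (tAct N₀ b β c k)) ≤ 1 := by
      rw [Real.exp_le_one_iff]
      have hm : max t (tAct N₀ b β c k) ≤ 0 := max_le ht.2 (h.tAct_le_zero k)
      have hA : 0 ≤ amp N₀ b β (k - 1) / 2 := by linarith [h.amp_pos (k - 1)]
      exact mul_nonpos_of_nonneg_of_nonpos hA hm
    have hA2 : 0 ≤ 2 * amp N₀ b β k := by linarith [h.amp_pos k]
    calc x t k ≤ 2 * amp N₀ b β k * Real.exp (amp N₀ b β (k - 1) / 2 * max t (tAct N₀ b β c k)) := hb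
      _ ≤ 2 * amp N₀ b β k * 1 := mul_le_mul_of_nonneg_left hexp hA2
      _ = 2 * amp N₀ b β k := mul_one _

/-- **Host pump bounds**: throughout the activation window `[t_{k+1}, 0]` of level `k+1` (length
`|t_{k+1}| = c/A_{k-1}`) the driving amplitude satisfies `¾A_k ≤ x_k ≤ 2A_k` — the solution-level form
of `η_k ≥ ¾A_k` (eta_quarter_bound) and `ζ_k ≤ 2A_k` (z_bound) used on the upper face in the proofs of
Prop. 3.3 / 3.4 ("`x_{k-1}x_k ≥ η_{k-1}ζ_k`", "`η_{k-1} - ρ_kN_k² ≥ ¾A_{k-1} - N_k² ≥ ½A_{k-1}`").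
[cite: Palasek2026ElementaryModel, §3.1 Lemma 3.2 (eta_quarter_bound), (z_bound); §3.3 proof of Prop. 3.4] -/
theorem host_pump (k : ℕ) {t : ℝ} (ht : t ∈ Icc (tAct N₀ b β c (k + 1)) 0) :
    3 / 4 * amp N₀ b β k ≤ x t k ∧ x t k ≤ 2 * amp N₀ b β k := by
  have ht' : t ∈ Icc (-horizon N₀ b β c) 0 := h.Icc_tAct_subset (k + 1) ht
  refine ⟨?_, h.le_two_mul_amp k ht'⟩
  rcases Nat.eq_zero_or_pos k with rfl | hk
  · have := (h.zero_bounds t ht').1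
    linarith [h.amp_pos 0]
  · exact h.quarter k hk t ht

/-- **Positivity**: every mode is strictly positive on `[-T, 0]` (mode `0` from `x₀ ≥ A₀`, mode `1` from
the quarter floor on `[t₂, 0] = [-T, 0]`, modes `k ≥ 2` from the global floor).
[cite: Palasek2026ElementaryModel, §3.3 Prop. 3.4 ("x has positive components") and §3.1 Lemma 3.2] -/
theorem pos (k : ℕ) {t : ℝ} (ht : t ∈ Icc (-horizon N₀ b β c) 0) : 0 < x t k := by
  rcases Nat.lt_or_ge k 2 with hk | hk
  · interval_cases k
    · linarith [(h.zero_bounds t ht).1, h.amp_pos 0]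
    · have h2 : tAct N₀ b β c (1 + 1) = -horizon N₀ b β c := tAct_two N₀ b β c
      have ht2 : t ∈ Icc (tAct N₀ b β c (1 + 1)) 0 := by rw [h2]; exact ht
      linarith [h.quarter 1 le_rfl t ht2, h.amp_pos 1]
  · exact lt_of_lt_of_le (mul_pos (h.amp_pos k) (Real.exp_pos _)) (h.global k hk t ht)

/-- **Frozen levels**: before its activation time a mode sits below its frozen barrier value,
`x_k(t) ≤ 2A_k exp(-(c/2)A_{k-1}/A_{k-2})` for `t ≤ t_k` (`k ≥ 1`; for `k ≥ 3` the exponent is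
`-(c/2)N_{k-2}^{β(b-1)} → -∞`, so at the activation time `t_k` of level `k` all levels `j ≥ k` are
exponentially small next to `A_j`). [cite: Palasek2026ElementaryModel, §3.3 (sol_bounds) with §3.1 Lemma 3.2 (z_bound) ("constant on [-T, t_k]")] -/
theorem frozen {k : ℕ} (hk : 1 ≤ k) {t : ℝ} (ht : t ∈ Icc (-horizon N₀ b β c) 0)
    (htk : t ≤ tAct N₀ b β c k) :
    x t k ≤ 2 * amp N₀ b β k * Real.exp (-(c / 2 * (amp N₀ b β (k - 1) / amp N₀ b β (k - 2)))) := by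
  have hb := (h.sol_bounds k hk t ht).2
  rwa [max_eq_right htk, amp_div_two_mul_tAct] at hb

/-- **The e-fold budget of a level** (the solution-level form of (eta_global_bound)): on all of
`[-T, 0]`, `log(A_k/x_k(t)) ≤ 5A_{k-1}/A_{k-2}` for `k ≥ 2` — a level never has more than
`5A_{k-1}/A_{k-2}` e-folds left to grow before the blow-up time.
[cite: Palasek2026ElementaryModel, §3.1 Lemma 3.2 (eta_global_bound); §3.3 Prop. 3.4] -/
theorem log_div_le {k : ℕ} (hk : 2 ≤ k) {t : ℝ} (ht : t ∈ Icc (-horizon N₀ b β c) 0) :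
    Real.log (amp N₀ b β k / x t k) ≤ 5 * (amp N₀ b β (k - 1) / amp N₀ b β (k - 2)) := by
  have hx := h.pos k ht
  have hA := h.amp_pos k
  rw [Real.log_le_iff_le_exp (div_pos hA hx), div_le_iff₀ hx]
  have hg := h.global k hk t ht
  have hE := Real.exp_pos (5 * (amp N₀ b β (k - 1) / amp N₀ b β (k - 2)))
  have hmul := mul_le_mul_of_nonneg_left hg hE.le
  have hcancel : Real.exp (5 * (amp N₀ b β (k - 1) / amp N₀ b β (k - 2))) *
      (amp N₀ b β k * Real.exp (-(5 * (amp N₀ b β (k - 1) / amp N₀ b β (k - 2))))) =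
        amp N₀ b β k := by
    rw [Real.exp_neg]
    field_simp
  rw [hcancel] at hmul
  linarith

/-- On the activation window of the next level the budget is `log(4/3)`: `log(A_k/x_k(t)) ≤ log(4/3)`
for `t ∈ [t_{k+1}, 0]`. [cite: Palasek2026ElementaryModel, §3.1 Lemma 3.2 (eta_quarter_bound)] -/
theorem log_div_le_of_mem_window (k : ℕ) {t : ℝ} (ht : t ∈ Icc (tAct N₀ b β c (k + 1)) 0) :
    Real.log (amp N₀ b β k / x t k) ≤ Real.log (4 / 3) := by
  have ht' : t ∈ Icc (-horizon N₀ b β c) 0 := h.Icc_tAct_subset (k + 1) ht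
  have hx := h.pos k ht'
  have hA := h.amp_pos k
  have hq := (h.host_pump k ht).1
  refine Real.log_le_log (div_pos hA hx) ?_
  rw [div_le_iff₀ hx]
  linarith

/-- **The force envelope**: for `ν ≥ 0` and `k ≥ 1`, on `[-T, 0]`,
`0 ≤ g_k(t) ≤ νN_k² · 2A_k · exp(-(c/4)A_{k-1}/A_{k-2})` — on its support `t ≤ t_k/2` one has
`max{t, t_k} ≤ t_k/2`, and `g_k ≡ 0` on `[t_k/2, 0]` (`forceTerm_amp_eq_zero`). For `k ≥ 3` the last
factor is the small factor `exp(-(c/4)N_{k-2}^{β(b-1)})` that defeats every polynomial weight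
((exp_small)); `g₀ ≡ 0` (`forceTerm_mode_zero`).
[cite: Palasek2026ElementaryModel, §3.3 proof of Thm 1.3 (first display)] -/
theorem forceTerm_le_smallFactor (hν : 0 ≤ ν) {k : ℕ} (hk : 1 ≤ k) {t : ℝ}
    (ht : t ∈ Icc (-horizon N₀ b β c) 0) :
    0 ≤ forceTerm ν (scale N₀ b) (amp N₀ b β) c x k t ∧
      forceTerm ν (scale N₀ b) (amp N₀ b β) c x k t ≤
        ν * scale N₀ b k ^ 2 * (2 * amp N₀ b β k) *
          Real.exp (-(c / 4 * (amp N₀ b β (k - 1) / amp N₀ b β (k - 2)))) := by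
  have hx := h.sol_bounds k hk t ht
  have hνN : 0 ≤ ν * scale N₀ b k ^ 2 := mul_nonneg hν (sq_nonneg _)
  have hA2 : 0 ≤ 2 * amp N₀ b β k := by linarith [h.amp_pos k]
  refine ⟨forceTerm_nonneg hν hx.1, ?_⟩
  rcases le_or_gt (tAct N₀ b β c k / 2) t with hle | hlt
  · rw [forceTerm_amp_eq_zero h.N₀_pos h.c_pos ν x hk hle]
    exact mul_nonneg (mul_nonneg hνN hA2) (Real.exp_pos _).le
  · have hmax : max t (tAct N₀ b β c k) ≤ tAct N₀ b β c k / 2 :=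
      max_le hlt.le (by linarith [h.tAct_le_zero k])
    have hexp : Real.exp (amp N₀ b β (k - 1) / 2 * max t (tAct N₀ b β c k)) ≤
        Real.exp (-(c / 4 * (amp N₀ b β (k - 1) / amp N₀ b β (k - 2)))) := by
      rw [Real.exp_le_exp, ← amp_div_two_mul_half_tAct]
      exact mul_le_mul_of_nonneg_left hmax (by linarith [h.amp_pos (k - 1)])
    calc forceTerm ν (scale N₀ b) (amp N₀ b β) c x k t
        ≤ ν * scale N₀ b k ^ 2 * x t k := forceTerm_le hν hx.1
      _ ≤ ν * scale N₀ b k ^ 2 *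
            (2 * amp N₀ b β k * Real.exp (amp N₀ b β (k - 1) / 2 * max t (tAct N₀ b β c k))) :=
          mul_le_mul_of_nonneg_left hx.2 hνN
      _ ≤ ν * scale N₀ b k ^ 2 * (2 * amp N₀ b β k *
            Real.exp (-(c / 4 * (amp N₀ b β (k - 1) / amp N₀ b β (k - 2))))) :=
          mul_le_mul_of_nonneg_left (mul_le_mul_of_nonneg_left hexp hA2) hνN
      _ = _ := by ring

end IsTowerSolution

/-! ### The truncated energy identity of Propositions 3.3 / 3.4 -/

section Energy

variable {α : ℝ} {N δ : ℕ → ℝ}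

/-- The truncated energy `e_K = Σ_{k ≤ K} ½N_k^{-2α}x_k²` of (truncated_e) in the rescaled unknowns
(`= ½Σ_{k≤K} X_k²` since `X_k = N_k^{-α}x_k`). [cite: Palasek2026ElementaryModel, §3.2 (truncated_e)] -/
def shellEnergy (N : ℕ → ℝ) (α : ℝ) (K : ℕ) (z : ℕ → ℝ) : ℝ :=
  ∑ k ∈ Finset.range (K + 1), 1 / 2 * N k ^ (-(2 * α)) * z k ^ 2

/-- **The Obukhov pair of interactions conserves energy, up to the flux into the first discarded
mode**: weighted by `N_k^{-2α}x_k`, the nonlinear terms `x_{k-1}x_k - δ_kx_{k+1}²` telescope over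
`k ≤ K` to `-N_{K+1}^{-2α}x_Kx_{K+1}²`, by the recurrence `δ_kN_k^{-2α} = N_{k+1}^{-2α}` ("the energy
transferred up by the first term is balanced by energy transferred down by the second term").
[cite: Palasek2026ElementaryModel, §3.2 proof of Prop. 3.3 (display "e_K'(t) = … = 0"); §2 footnote] -/
theorem sum_weighted_transfer_eq (hδ : ∀ k, δ k * N k ^ (-(2 * α)) = N (k + 1) ^ (-(2 * α)))
    (z : ℕ → ℝ) (K : ℕ) :
    ∑ k ∈ Finset.range (K + 1),
        N k ^ (-(2 * α)) * z k * ((if k = 0 then 0 else z (k - 1) * z k) - δ k * z (k + 1) ^ 2) =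
      -(N (K + 1) ^ (-(2 * α)) * z K * z (K + 1) ^ 2) := by
  induction K with
  | zero =>
    rw [Finset.sum_range_one, if_pos rfl, ← hδ 0]
    ring
  | succ K ih =>
    rw [Finset.sum_range_succ, ih, if_neg (Nat.succ_ne_zero K), Nat.add_sub_cancel, ← hδ (K + 1)]
    ring

/-- **The truncated energy identity (Prop. 3.3 / 3.4)**: for a solution of the truncated system on the
modes `k ≤ K` (state vanishing at mode `K+1`), `e_K'(t) = -Σ_{k≤K} visc_k(t)N_k^{-2α}x_k(t)²`; with
`visc_k = ρ_kνN_k²` this is the printed `e_K' + Σ_{k≤K} ρ_kN_k^{2-2α}x_k² = 0` (`ν = 1`), and in the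
inviscid case (`visc ≡ 0`) `e_K' = 0`. [cite: Palasek2026ElementaryModel, §3.2 proof of Prop. 3.3; §3.3 proof of Prop. 3.4 (energy identity)] -/
theorem hasDerivWithinAt_shellEnergy {visc : ℕ → ℝ → ℝ} {x : ℝ → ℕ → ℝ} {s : Set ℝ} {t : ℝ}
    {K : ℕ} (hδ : ∀ k, δ k * N k ^ (-(2 * α)) = N (k + 1) ^ (-(2 * α)))
    (hode : ∀ k ≤ K, HasDerivWithinAt (fun r => x r k) (truncRHS δ visc t (x t) k) s t)
    (hoff : x t (K + 1) = 0) :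
    HasDerivWithinAt (fun r => shellEnergy N α K (x r))
      (-(∑ k ∈ Finset.range (K + 1), visc k t * N k ^ (-(2 * α)) * x t k ^ 2)) s t := by
  have hsum : HasDerivWithinAt (fun r => shellEnergy N α K (x r))
      (∑ k ∈ Finset.range (K + 1),
        1 / 2 * N k ^ (-(2 * α)) * (2 * x t k * truncRHS δ visc t (x t) k)) s t := by
    unfold shellEnergy
    refine HasDerivWithinAt.fun_sum fun k hk => ?_
    have hk' : k ≤ K := Nat.lt_succ_iff.1 (Finset.mem_range.1 hk)
    have h2 : HasDerivWithinAt (fun r => x r k ^ 2) (2 * x t k * truncRHS δ visc t (x t) k) s t := by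
      simpa using (hode k hk').fun_pow 2
    exact h2.const_mul _
  have heq : ∑ k ∈ Finset.range (K + 1),
        1 / 2 * N k ^ (-(2 * α)) * (2 * x t k * truncRHS δ visc t (x t) k) =
      -(∑ k ∈ Finset.range (K + 1), visc k t * N k ^ (-(2 * α)) * x t k ^ 2) := by
    have hsplit : ∀ k ∈ Finset.range (K + 1),
        1 / 2 * N k ^ (-(2 * α)) * (2 * x t k * truncRHS δ visc t (x t) k) =
          -(visc k t * N k ^ (-(2 * α)) * x t k ^ 2) +
            N k ^ (-(2 * α)) * x t k *
              ((if k = 0 then 0 else x t (k - 1) * x t k) - δ k * x t (k + 1) ^ 2) := by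
      intro k _
      unfold truncRHS
      ring
    rw [Finset.sum_congr rfl hsplit, Finset.sum_add_distrib, sum_weighted_transfer_eq hδ, hoff,
      Finset.sum_neg_distrib]
    ring
  rw [heq] at hsum
  exact hsum

end Energy

/-! ### The terminal phase of a level: the two-sided exponential corridor

Readings of the STRUCTURE of the rescaled system (x_system_nondimensionalized) — "the growth rate of
`x_k` is precisely `x_{k-1}`, while the unfavorable high-high-low term is scaled by the small
dimensionless parameter `δ_k`" (§3, p. 8) — together with the printed envelope (sol_bounds): on its
activation window a level lives in the corridor `A_k e^{2A_{k-1}t} ≤ x_k(t) ≤ 2A_k e^{½A_{k-1}t}`,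
so the time it spends above any fixed fraction of its final amplitude `A_k`, measured in host
turnovers `1/A_{k-1}`, is pinned between explicit logarithms. This is the model-side form of the
heuristic growth clock of §1.3.1, `T_k = (N_{k-1}^α A_{k-1})^{-1} log(A_k/X_k^0)` ("growth time =
e-folds ÷ pump"; in tower coordinates the pump `N_{k-1}^α X_{k-1}` is `x_{k-1}`), with the constants
the proof actually certifies (pump `≤ 2A_{k-1}` from above, barrier rate `½A_{k-1}` from below), and
the exact size `δ_kA_{k+1}²/A_k² = N_k^{-2(α-β)(b-1)}` of the back-reaction that the corridor ignores
(Lemma 3.2, Case 2). No new analysis: one monotonicity argument (`antitoneOn_of_hasDerivWithinAt_nonpos`)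
on `log x_k(t) - 2A_{k-1}t`. -/

section BackReaction

variable {N₀ : ℝ}

/-- **The back-reaction ratio of Lemma 3.2 (Cases 1–2), exactly**:
`δ_k A_{k+1}²/A_k² = N_k^{-2(α-β)(b-1)}` — the printed display
"`δ_kA_{k+1}²/A_k² = (N_{k+1}/N_k)^{-2α+2β} = N_0^{-2(α-β)(b-1)b^k}`", i.e. the size of the
high-high→low term `δ_kζ_{k+1}²` at the top of the next level relative to `A_k²`; "using the
assumption `β < α` … this quantity too can be made small with the choice of `N₀`" (its eventual form
with the constant `8` is `eventually_S2`). [cite: Palasek2026ElementaryModel, §3.1 Lemma 3.2 proof, Case 1–2 (p. 8)] -/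
theorem delta_mul_amp_succ_sq_div (hN₀ : 0 < N₀) (b α β : ℝ) (k : ℕ) :
    delta N₀ b α k * amp N₀ b β (k + 1) ^ 2 / amp N₀ b β k ^ 2 =
      scale N₀ b k ^ (-(2 * (α - β) * (b - 1))) := by
  have e2 : ∀ y : ℝ, Real.exp y ^ 2 = Real.exp (2 * y) := fun y => by
    rw [sq, ← Real.exp_add, two_mul]
  rw [Real.rpow_def_of_pos (scale_pos hN₀ b k), scale_eq_exp hN₀, Real.log_exp, delta_eq_exp hN₀,
    amp_eq_exp hN₀, amp_eq_exp hN₀, e2, e2, ← Real.exp_add, ← Real.exp_sub]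
  congr 1
  ring

/-- The same ratio one level down, in the form the host sees it: `δ_{k-1}A_k²/A_{k-1}² → 0` is the
statement that the drain `-δ_{k-1}x_k²` on the host stays below the host's own pump `x_{k-2}x_{k-1}`
while level `k` tops out (Lemma 3.2, Case 2: "`ζ_k(t) ≤ 2A_ke^{½A_{k-1}t}` after increasing `N₀` if
necessary"); as a pure power of the host frequency the exponent is `-2(α-β)(b-1) < 0` exactly when
`β < α` and `b > 1`. [cite: Palasek2026ElementaryModel, §3.1 Lemma 3.2 proof, Case 2 (p. 8); (viscous_A_assumptions)] -/
theorem backReaction_exponent_neg {b α β : ℝ} (hb : 1 < b) (hβα : β < α) :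
    -(2 * (α - β) * (b - 1)) < 0 := by
  have h1 : 0 < α - β := sub_pos.2 hβα
  have h2 : 0 < b - 1 := sub_pos.2 hb
  nlinarith [mul_pos h1 h2]

end BackReaction

namespace IsTowerSolution

variable {ν α N₀ b β c : ℝ} {x : ℝ → ℕ → ℝ} (h : IsTowerSolution ν α N₀ b β c x)
include h

/-- `0 ∈ [-T, 0]`: the blow-up time is the right end of the lifespan. [cite: Palasek2026ElementaryModel, §3.1 (tk_times_def)] -/
theorem zero_mem_Icc : (0 : ℝ) ∈ Icc (-horizon N₀ b β c) 0 :=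
  ⟨by linarith [h.horizon_pos], le_rfl⟩

/-- **"The growth rate of `x_k` is precisely `x_{k-1}`", as an inequality along the tower**: for
`ν ≥ 0` and `k ≥ 1`, at every `t ∈ [-T, 0]` the right-hand side of the cut-off system is at most
`x_{k-1}(t)x_k(t) ≤ 2A_{k-1}x_k(t)` — the dissipation `-ρ_kνN_k²x_k`, the high-high→low term
`-δ_kx_{k+1}²` and the cut-off only lower it, and the pump is read off the host ceiling
`x_{k-1} ≤ 2A_{k-1}` of (sol_bounds). [cite: Palasek2026ElementaryModel, §3 (x_system_nondimensionalized) p. 8 with §3.3 (sol_bounds)] -/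
theorem truncRHS_le_two_mul_amp_mul (hν : 0 ≤ ν) {k : ℕ} (hk : 1 ≤ k) {t : ℝ}
    (ht : t ∈ Icc (-horizon N₀ b β c) 0) :
    truncRHS (delta N₀ b α) (viscCoeff ν (scale N₀ b) (amp N₀ b β) c) t (x t) k ≤
      2 * amp N₀ b β (k - 1) * x t k := by
  have hxk := (h.pos k ht).le
  have hk0 : k ≠ 0 := by omega
  have h1 : 0 ≤ viscCoeff ν (scale N₀ b) (amp N₀ b β) c k t * x t k :=
    mul_nonneg (viscCoeff_nonneg hν (scale N₀ b) (amp N₀ b β) c k t) hxk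
  have h2 : 0 ≤ delta N₀ b α k * x t (k + 1) ^ 2 :=
    mul_nonneg (delta_pos h.N₀_pos b α k).le (sq_nonneg _)
  have h3 : x t (k - 1) * x t k ≤ 2 * amp N₀ b β (k - 1) * x t k :=
    mul_le_mul_of_nonneg_right (h.le_two_mul_amp (k - 1) ht) hxk
  unfold truncRHS
  rw [if_neg hk0]
  linarith

/-- **Growth-rate cap, integrated**: for `ν ≥ 0`, `k ≥ 1` and `-T ≤ s ≤ t ≤ 0`,
`x_k(t) ≤ x_k(s)·exp(2A_{k-1}(t - s))` — a level gains at most `2A_{k-1}` e-folds per unit time,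
i.e. at most two e-folds per host turnover `1/A_{k-1}`, whatever the levels above and below it do
(`log x_k(t) - 2A_{k-1}t` is non-increasing on `[-T, 0]`). This is the rigorous form, for the
constructed tower, of the §1.3.1 bookkeeping "`X_k` grows exponentially at rate `N_{k-1}^αX_{k-1}`
… and would arrive at `A_k` after growing for approximately time `T_k`".
[cite: Palasek2026ElementaryModel, §3 (x_system_nondimensionalized) p. 8, §3.3 (sol_bounds); §1.3.1 (T_k) p. 5] -/
theorem le_mul_exp_of_le (hν : 0 ≤ ν) {k : ℕ} (hk : 1 ≤ k) {s t : ℝ}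
    (hs : s ∈ Icc (-horizon N₀ b β c) 0) (ht : t ∈ Icc (-horizon N₀ b β c) 0) (hst : s ≤ t) :
    x t k ≤ x s k * Real.exp (2 * amp N₀ b β (k - 1) * (t - s)) := by
  have hanti : AntitoneOn (fun r => Real.log (x r k) - 2 * amp N₀ b β (k - 1) * r)
      (Icc (-horizon N₀ b β c) 0) := by
    refine antitoneOn_of_hasDerivWithinAt_nonpos (convex_Icc _ _)
      (f' := fun r =>
        truncRHS (delta N₀ b α) (viscCoeff ν (scale N₀ b) (amp N₀ b β) c) r (x r) k / x r k -
          2 * amp N₀ b β (k - 1))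
      ?_ ?_ ?_
    · exact ((h.continuousOn k).log fun r hr => (h.pos k hr).ne').sub
        (continuous_const.mul continuous_id).continuousOn
    · intro r hr
      have hr' : r ∈ Icc (-horizon N₀ b β c) 0 := interior_subset hr
      have hd := ((h.hasDeriv k r hr').mono interior_subset).log (h.pos k hr').ne'
      have hl : HasDerivWithinAt (fun r : ℝ => 2 * amp N₀ b β (k - 1) * r)
          (2 * amp N₀ b β (k - 1)) (interior (Icc (-horizon N₀ b β c) 0)) r := by
        simpa using (hasDerivWithinAt_id r _).const_mul (2 * amp N₀ b β (k - 1))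
      exact hd.sub hl
    · intro r hr
      have hr' : r ∈ Icc (-horizon N₀ b β c) 0 := interior_subset hr
      have hx := h.pos k hr'
      have hle := h.truncRHS_le_two_mul_amp_mul hν hk hr'
      show truncRHS (delta N₀ b α) (viscCoeff ν (scale N₀ b) (amp N₀ b β) c) r (x r) k / x r k -
          2 * amp N₀ b β (k - 1) ≤ 0
      rw [sub_nonpos, div_le_iff₀ hx]
      exact hle
  have hφ : Real.log (x t k) - 2 * amp N₀ b β (k - 1) * t ≤
      Real.log (x s k) - 2 * amp N₀ b β (k - 1) * s := hanti hs ht hst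
  have hxt := h.pos k ht
  have hxs := h.pos k hs
  have hE := Real.exp_pos (2 * amp N₀ b β (k - 1) * (t - s))
  rw [← Real.log_le_log_iff hxt (mul_pos hxs hE), Real.log_mul hxs.ne' hE.ne', Real.log_exp]
  linarith

/-- **Lower edge of the terminal corridor**: for `ν ≥ 0` and `k ≥ 1`,
`A_k·exp(2A_{k-1}t) ≤ x_k(t)` on all of `[-T, 0]` — read backward from the blow-up profile
`x_k(0) = A_k`, a level is never more than `2A_{k-1}|t|` e-folds short of its final amplitude
(two e-folds per remaining host turnover). Together with (sol_bounds) this is the corridor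
`A_k e^{2A_{k-1}t} ≤ x_k(t) ≤ 2A_k e^{½A_{k-1}t}` on `[t_k, 0]`. [cite: Palasek2026ElementaryModel, §3 (x_system_nondimensionalized) p. 8, §3.3 (sol_bounds) and Prop. 3.4 (x_k(0) = A_k)] -/
theorem amp_mul_exp_le (hν : 0 ≤ ν) {k : ℕ} (hk : 1 ≤ k) {t : ℝ}
    (ht : t ∈ Icc (-horizon N₀ b β c) 0) :
    amp N₀ b β k * Real.exp (2 * amp N₀ b β (k - 1) * t) ≤ x t k := by
  have h1 := h.le_mul_exp_of_le hν hk ht h.zero_mem_Icc ht.2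
  rw [h.terminal k] at h1
  have hE := Real.exp_pos (2 * amp N₀ b β (k - 1) * t)
  have h2 := mul_le_mul_of_nonneg_right h1 hE.le
  have h3 : x t k * Real.exp (2 * amp N₀ b β (k - 1) * (0 - t)) *
      Real.exp (2 * amp N₀ b β (k - 1) * t) = x t k := by
    rw [mul_assoc, ← Real.exp_add]
    have : 2 * amp N₀ b β (k - 1) * (0 - t) + 2 * amp N₀ b β (k - 1) * t = 0 := by ring
    rw [this, Real.exp_zero, mul_one]
  rw [h3] at h2
  exact h2

/-- **The remaining e-fold count is at most twice the remaining host turnovers**: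
`log(A_k/x_k(t)) ≤ 2A_{k-1}|t|` for `ν ≥ 0`, `k ≥ 1`, `t ∈ [-T, 0]` (compare the trapping budget
`log_div_le`: `≤ 5A_{k-1}/A_{k-2}` uniformly; this one is linear in the time to blow-up and is the
sharper of the two after `t = -(5/2)/A_{k-2}`, i.e. inside the last `2½` turnovers of level `k-2`).
[cite: Palasek2026ElementaryModel, §3 (x_system_nondimensionalized) p. 8, §3.3 (sol_bounds); §1.3.1 (T_k) p. 5] -/
theorem log_div_le_two_mul_amp_mul_neg (hν : 0 ≤ ν) {k : ℕ} (hk : 1 ≤ k) {t : ℝ}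
    (ht : t ∈ Icc (-horizon N₀ b β c) 0) :
    Real.log (amp N₀ b β k / x t k) ≤ 2 * amp N₀ b β (k - 1) * (-t) := by
  have hx := h.pos k ht
  have hA := h.amp_pos k
  have hlow := h.amp_mul_exp_le hν hk ht
  rw [Real.log_le_iff_le_exp (div_pos hA hx), div_le_iff₀ hx]
  have hE := Real.exp_pos (2 * amp N₀ b β (k - 1) * (-t))
  have h2 := mul_le_mul_of_nonneg_right hlow hE.le
  have h3 : amp N₀ b β k * Real.exp (2 * amp N₀ b β (k - 1) * t) *
      Real.exp (2 * amp N₀ b β (k - 1) * (-t)) = amp N₀ b β k := by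
    rw [mul_assoc, ← Real.exp_add]
    have : 2 * amp N₀ b β (k - 1) * t + 2 * amp N₀ b β (k - 1) * (-t) = 0 := by ring
    rw [this, Real.exp_zero, mul_one]
  rw [h3] at h2
  linarith

/-- **A level is near its final amplitude only briefly (upper edge of the corridor)**: if
`x_k(t) ≥ θA_k` at some `t` of the activation window `[t_k, 0]` (`k ≥ 1`, `θ > 0`), then
`½A_{k-1}|t| ≤ log(2/θ)` — at most `2 log(2/θ)` host turnovers before the blow-up time; for
`θ > 2e^{-c A_{k-1}/(2A_{k-2})}` this confines such `t` to a proper terminal sub-window. From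
(sol_bounds): `θA_k ≤ x_k(t) ≤ 2A_k e^{½A_{k-1}t}` on `[t_k, 0]`.
[cite: Palasek2026ElementaryModel, §3.3 (sol_bounds) / Prop. 3.4 (uniform_truncated_bounds_viscous)] -/
theorem half_amp_mul_neg_le_log {k : ℕ} (hk : 1 ≤ k) {t θ : ℝ} (hθ : 0 < θ)
    (ht : t ∈ Icc (tAct N₀ b β c k) 0) (hx : θ * amp N₀ b β k ≤ x t k) :
    amp N₀ b β (k - 1) / 2 * (-t) ≤ Real.log (2 / θ) := by
  have ht' : t ∈ Icc (-horizon N₀ b β c) 0 := h.Icc_tAct_subset k ht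
  have hb := (h.sol_bounds k hk t ht').2
  rw [max_eq_left ht.1] at hb
  have hA := h.amp_pos k
  have h1 : θ * amp N₀ b β k ≤
      2 * Real.exp (amp N₀ b β (k - 1) / 2 * t) * amp N₀ b β k := by
    calc θ * amp N₀ b β k ≤ x t k := hx
      _ ≤ 2 * amp N₀ b β k * Real.exp (amp N₀ b β (k - 1) / 2 * t) := hb
      _ = 2 * Real.exp (amp N₀ b β (k - 1) / 2 * t) * amp N₀ b β k := by ring
  have h2 : θ ≤ 2 * Real.exp (amp N₀ b β (k - 1) / 2 * t) := le_of_mul_le_mul_right h1 hA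
  have h3 : Real.log (θ / 2) ≤ amp N₀ b β (k - 1) / 2 * t := by
    rw [Real.log_le_iff_le_exp (by positivity)]
    linarith
  rw [Real.log_div hθ.ne' two_ne_zero] at h3
  rw [Real.log_div two_ne_zero hθ.ne']
  linarith

/-- `log(2A_k/A_{k-1}) = β(b-1) log N_{k-1} + log 2` for `k ≥ 1`: the e-fold distance from host
parity `x_k = A_{k-1}` to the ceiling `2A_k`. [cite: Palasek2026ElementaryModel, §3.1 (ratios) p. 8] -/
theorem log_two_mul_amp_div {k : ℕ} (hk : 1 ≤ k) :
    Real.log (2 * amp N₀ b β k / amp N₀ b β (k - 1)) =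
      β * (b - 1) * Real.log (scale N₀ b (k - 1)) + Real.log 2 := by
  obtain ⟨j, rfl⟩ : ∃ j, k = j + 1 := ⟨k - 1, by omega⟩
  have hA := h.amp_pos j
  have hA' := h.amp_pos (j + 1)
  rw [Nat.add_sub_cancel, mul_div_assoc, Real.log_mul two_ne_zero (div_pos hA' hA).ne',
    log_amp_succ_div h.N₀_pos, add_comm]

/-- **Vorticity parity with the host is a terminal event — upper bound on its duration**: if at some
`t ∈ [t_k, 0]` level `k ≥ 1` has reached the host amplitude, `x_k(t) ≥ A_{k-1}` (in the dictionary
of §2–§3: `‖P_kω‖_∞ ≥ ‖P_{k-1}ω‖_∞` at the profile), then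
`A_{k-1}|t| ≤ 2 log(2A_k/A_{k-1}) = 2(β(b-1) log N_{k-1} + log 2)`: every instant of parity lies
within the last `2β(b-1) log N_{k-1} + 2 log 2` host turnovers before the blow-up time.
[cite: Palasek2026ElementaryModel, §3.3 (sol_bounds); §3.1 (ratios) p. 8] -/
theorem amp_mul_neg_le_of_parity {k : ℕ} (hk : 1 ≤ k) {t : ℝ} (ht : t ∈ Icc (tAct N₀ b β c k) 0)
    (hx : amp N₀ b β (k - 1) ≤ x t k) :
    amp N₀ b β (k - 1) * (-t) ≤
      2 * (β * (b - 1) * Real.log (scale N₀ b (k - 1)) + Real.log 2) := by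
  have hA := h.amp_pos (k - 1)
  have hA' := h.amp_pos k
  have hθ : 0 < amp N₀ b β (k - 1) / amp N₀ b β k := div_pos hA hA'
  have hx' : amp N₀ b β (k - 1) / amp N₀ b β k * amp N₀ b β k ≤ x t k := by
    rwa [div_mul_cancel₀ _ hA'.ne']
  have h1 := h.half_amp_mul_neg_le_log hk hθ ht hx'
  have h2 : (2 : ℝ) / (amp N₀ b β (k - 1) / amp N₀ b β k) = 2 * amp N₀ b β k / amp N₀ b β (k - 1) := by
    field_simp
  rw [h2, h.log_two_mul_amp_div hk] at h1
  linarith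

/-- **Vorticity parity — lower bound on its duration**: for `ν ≥ 0` and `k ≥ 1`, level `k` is at or
above the host amplitude, `x_k(t) ≥ A_{k-1}`, at every `t ∈ [-T, 0]` with
`2A_{k-1}|t| ≤ log(A_k/A_{k-1}) = β(b-1) log N_{k-1}`: the parity phase covers at least the last
`½β(b-1) log N_{k-1}` host turnovers (lower edge of the corridor, `amp_mul_exp_le`). With
`amp_mul_neg_le_of_parity`: the terminal (parity) phase lasts between `½` and `2` times
`β(b-1) log N_{k-1}` host turnovers, up to the additive `2 log 2`.
[cite: Palasek2026ElementaryModel, §3 (x_system_nondimensionalized) p. 8, §3.3 (sol_bounds); §3.1 (ratios)] -/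
theorem parity_of_late (hν : 0 ≤ ν) {k : ℕ} (hk : 1 ≤ k) {t : ℝ}
    (ht : t ∈ Icc (-horizon N₀ b β c) 0)
    (hlate : 2 * amp N₀ b β (k - 1) * (-t) ≤ β * (b - 1) * Real.log (scale N₀ b (k - 1))) :
    amp N₀ b β (k - 1) ≤ x t k := by
  have hA := h.amp_pos (k - 1)
  have hA' := h.amp_pos k
  have hlow := h.amp_mul_exp_le hν hk ht
  obtain ⟨j, rfl⟩ : ∃ j, k = j + 1 := ⟨k - 1, by omega⟩
  rw [Nat.add_sub_cancel] at hlate hlow hA ⊢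
  -- `A_j / A_{j+1} = exp(-β(b-1) log N_j) ≤ exp(2A_j t)`
  have hratio : amp N₀ b β j = amp N₀ b β (j + 1) *
      Real.exp (-(β * (b - 1) * Real.log (scale N₀ b j))) := by
    have e := log_amp_succ_div h.N₀_pos b β j
    have hq : 0 < amp N₀ b β (j + 1) / amp N₀ b β j := div_pos hA' hA
    have e' : amp N₀ b β (j + 1) / amp N₀ b β j =
        Real.exp (β * (b - 1) * Real.log (scale N₀ b j)) := by
      rw [← e, Real.exp_log hq]
    rw [Real.exp_neg, ← e']
    field_simp
  rw [hratio]
  refine le_trans (mul_le_mul_of_nonneg_left ?_ hA'.le) hlow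
  rw [Real.exp_le_exp]
  linarith

/-- **The level-0 reservoir only drains**: for `ν ≥ 0` the host amplitude `x₀` is non-increasing on
`[-T, 0]` (`x₀' = -ρ₀νN₀²x₀ - δ₀x₁² ≤ 0`: mode `0` has no pump, `x_{-1} ≡ 0`, and no force,
`g₀ ≡ 0`), falling from `x₀(-T) ≤ 2A₀` to the profile value `x₀(0) = A₀`; in particular `x₀ ≥ A₀`
throughout, the lower half of (z0_bound) recovered from the dynamics.
[cite: Palasek2026ElementaryModel, §3 (x_system_nondimensionalized) with x_{-1} ≡ 0 (p. 8); §3.3 "g₀(t) = 0" (p. 10); Lemma 3.2 (z0_bound)] -/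
theorem antitoneOn_zero (hν : 0 ≤ ν) : AntitoneOn (fun r => x r 0) (Icc (-horizon N₀ b β c) 0) := by
  refine antitoneOn_of_hasDerivWithinAt_nonpos (convex_Icc _ _)
    (f' := fun r => truncRHS (delta N₀ b α) (viscCoeff ν (scale N₀ b) (amp N₀ b β) c) r (x r) 0)
    (h.continuousOn 0) (fun r hr => (h.hasDeriv 0 r (interior_subset hr)).mono interior_subset) ?_
  intro r hr
  have hr' : r ∈ Icc (-horizon N₀ b β c) 0 := interior_subset hr
  have h1 : 0 ≤ viscCoeff ν (scale N₀ b) (amp N₀ b β) c 0 r * x r 0 :=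
    mul_nonneg (viscCoeff_nonneg hν (scale N₀ b) (amp N₀ b β) c 0 r) (h.pos 0 hr').le
  have h2 : 0 ≤ delta N₀ b α 0 * x r (0 + 1) ^ 2 :=
    mul_nonneg (delta_pos h.N₀_pos b α 0).le (sq_nonneg _)
  show truncRHS (delta N₀ b α) (viscCoeff ν (scale N₀ b) (amp N₀ b β) c) r (x r) 0 ≤ 0
  unfold truncRHS
  rw [if_pos rfl]
  linarith

end IsTowerSolution

/-! ### Remark 1.10 in the model: modes above a gap in the data never switch on

The mechanism behind "the blow-up is unstable in every `𝒞^s`" (Rem. 1.10), in the form the tree can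
state without the model's local well-posedness theory (which the source does "not expound upon",
§1.2): FORWARD support stability of the truncated systems of Prop. 3.3 / 3.4. -/

section Support

variable {δ : ℕ → ℝ} {visc : ℕ → ℝ → ℝ}

/-- **Remark 1.10 («the blow-up is unstable»), model mechanism: modes above a spectral gap in the
data stay zero.** "If one truncates the initial data above some `k_*`, the solution stays supported
below `k_*` for all `t > 0`." For the truncated systems (truncated_inviscid)/(truncated_viscous) of
Prop. 3.3 / 3.4 — modes `k ≤ K`, state vanishing at mode `K+1`, ANY nonnegative (cut-off) dissipation
`visc_k(t) ≥ 0` and any coefficients `δ_k` — read FORWARD in time on `[t₀, t₁]`: if the modes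
`k_* < i ≤ K` vanish at `t₀`, they vanish on all of `[t₀, t₁]`. Each such mode is driven only through
`x_{i-1}x_i` and `-δ_ix_{i+1}²`, both zero on the zero section; the proof is an energy–Grönwall
argument on `Σ_{k_* < i ≤ K} x_i²` using only continuity of the modes (no uniqueness theorem is
invoked). Consequence for the reading of §3: the blow-up profile has `x_k(0) = A_k ≠ 0` at EVERY
level, so a datum truncated above `k_*` — as close as desired to the constructed datum in every `𝒞^s`,
the datum being in `𝒞^∞` — never produces it; the printed construction is a TERMINAL-value one
("designate the desired blow-up profile `X_k(0) = A_k` and evolve the (truncated) system backward in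
time", §1.3.1), and its floors (eta_quarter_bound)/(eta_global_bound) are properties of that one
solution, not of forward solutions from a class of data.
[cite: Palasek2026ElementaryModel, §1.2 Rem. 1.10 (p. 5); §3.2 (truncated_inviscid), §3.3 (truncated_viscous); §1.3.1 last paragraph (p. 5)] -/
theorem truncated_support_stable {x : ℝ → ℕ → ℝ} {t₀ t₁ : ℝ} {K kstar : ℕ}
    (hvisc : ∀ k t, 0 ≤ visc k t)
    (hode : ∀ k ≤ K, ∀ t ∈ Icc t₀ t₁,
      HasDerivWithinAt (fun r => x r k) (truncRHS δ visc t (x t) k) (Icc t₀ t₁) t)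
    (hoff : ∀ t ∈ Icc t₀ t₁, x t (K + 1) = 0)
    (hzero : ∀ i, kstar < i → i ≤ K → x t₀ i = 0)
    {t : ℝ} (ht : t ∈ Icc t₀ t₁) {i : ℕ} (hi : kstar < i) (hiK : i ≤ K) : x t i = 0 := by
  have ht₀ : t₀ ∈ Icc t₀ t₁ := ⟨le_rfl, ht.1.trans ht.2⟩
  -- continuity and a uniform bound `M` of the modes `≤ K` on `[t₀, t₁]`
  have hcont : ∀ k ≤ K, ContinuousOn (fun r => x r k) (Icc t₀ t₁) := fun k hk r hr =>
    (hode k hk r hr).continuousWithinAt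
  have hbd : ∀ k, ∃ C : ℝ, 0 ≤ C ∧ (k ≤ K → ∀ r ∈ Icc t₀ t₁, |x r k| ≤ C) := by
    intro k
    by_cases hk : k ≤ K
    · obtain ⟨C, hC⟩ := isCompact_Icc.exists_bound_of_continuousOn (hcont k hk)
      refine ⟨max C 0, le_max_right _ _, fun _ r hr => ?_⟩
      have h1 : ‖x r k‖ ≤ C := hC r hr
      rw [Real.norm_eq_abs] at h1
      exact h1.trans (le_max_left _ _)
    · exact ⟨0, le_rfl, fun h => absurd h hk⟩
  choose C hC0 hC using hbd
  set M := ∑ k ∈ Finset.range (K + 1), C k with hM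
  have hCM : ∀ k ≤ K, C k ≤ M := fun k hk =>
    Finset.single_le_sum (f := C) (fun j _ => hC0 j) (Finset.mem_range.2 (Nat.lt_succ_of_le hk))
  have hM0 : 0 ≤ M := Finset.sum_nonneg fun j _ => hC0 j
  have hxM : ∀ k ≤ K, ∀ r ∈ Icc t₀ t₁, |x r k| ≤ M := fun k hk r hr =>
    (hC k hk r hr).trans (hCM k hk)
  -- the energy above the gap, `E(r) = Σ_{k_* < j ≤ K} x_j(r)²`, and its derivative
  set S := Finset.Ioc kstar K with hS
  set Dδ := ∑ j ∈ S, |δ j| with hDδ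
  set Cg := 2 * M + 2 * M * Dδ with hCg
  have hE_nonneg : ∀ r, 0 ≤ ∑ j ∈ S, x r j ^ 2 := fun r => Finset.sum_nonneg fun j _ => sq_nonneg _
  have hE_deriv : ∀ r ∈ Icc t₀ t₁, HasDerivWithinAt (fun s => ∑ j ∈ S, x s j ^ 2)
      (∑ j ∈ S, 2 * x r j * truncRHS δ visc r (x r) j) (Icc t₀ t₁) r := by
    intro r hr
    refine HasDerivWithinAt.fun_sum fun j hj => ?_
    have hjK : j ≤ K := (Finset.mem_Ioc.1 hj).2
    simpa using (hode j hjK r hr).fun_pow 2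
  -- the differential inequality `E' ≤ Cg·E`
  have hineq : ∀ r ∈ Icc t₀ t₁, ∑ j ∈ S, 2 * x r j * truncRHS δ visc r (x r) j ≤
      Cg * ∑ j ∈ S, x r j ^ 2 := by
    intro r hr
    set E := ∑ l ∈ S, x r l ^ 2 with hE
    have hE0 : 0 ≤ E := hE_nonneg r
    have hterm : ∀ j ∈ S, 2 * x r j * truncRHS δ visc r (x r) j ≤
        2 * M * x r j ^ 2 + 2 * M * E * |δ j| := by
      intro j hj
      obtain ⟨hj1, hj2⟩ := Finset.mem_Ioc.1 hj
      have hj0 : j ≠ 0 := by omega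
      have hxj : |x r j| ≤ M := hxM j hj2 r hr
      have hxjm : x r (j - 1) ≤ M := (le_abs_self _).trans (hxM (j - 1) (by omega) r hr)
      -- the next mode squared is below the energy (or zero at the truncation edge)
      have hnext : x r (j + 1) ^ 2 ≤ E := by
        rcases Nat.lt_or_ge j K with hjK | hjK
        · have hmem : j + 1 ∈ S := Finset.mem_Ioc.2 ⟨by omega, hjK⟩
          exact Finset.single_le_sum (f := fun l => x r l ^ 2) (fun l _ => sq_nonneg _) hmem
        · have hjK' : j = K := le_antisymm hj2 hjK
          rw [hjK', hoff r hr]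
          simpa using hE0
      -- dissipation only lowers the energy
      have hv : 0 ≤ visc j r * x r j * x r j := by
        have := mul_nonneg (hvisc j r) (mul_self_nonneg (x r j))
        linarith [this, mul_assoc (visc j r) (x r j) (x r j)]
      -- the pump is bounded by the host bound `M`
      have hp : x r (j - 1) * x r j * x r j ≤ M * x r j ^ 2 := by
        rw [mul_assoc, ← sq]
        exact mul_le_mul_of_nonneg_right hxjm (sq_nonneg _)
      -- the back-reaction is bounded by `|δ_j| M x_{j+1}² ≤ |δ_j| M E`
      have hb1 : -(δ j * x r j) ≤ |δ j| * M :=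
        calc -(δ j * x r j) ≤ |δ j * x r j| := neg_le_abs _
          _ = |δ j| * |x r j| := abs_mul _ _
          _ ≤ |δ j| * M := mul_le_mul_of_nonneg_left hxj (abs_nonneg _)
      have hb2 : -(δ j * x r j) * x r (j + 1) ^ 2 ≤ |δ j| * M * E :=
        calc -(δ j * x r j) * x r (j + 1) ^ 2 ≤ |δ j| * M * x r (j + 1) ^ 2 :=
              mul_le_mul_of_nonneg_right hb1 (sq_nonneg _)
          _ ≤ |δ j| * M * E := mul_le_mul_of_nonneg_left hnext (by positivity)
      have hexp : 2 * x r j * truncRHS δ visc r (x r) j =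
          -(2 * (visc j r * x r j * x r j)) + 2 * (x r (j - 1) * x r j * x r j) +
            2 * (-(δ j * x r j) * x r (j + 1) ^ 2) := by
        unfold truncRHS
        rw [if_neg hj0]
        ring
      rw [hexp]
      nlinarith [hv, hp, hb2]
    have hsum := Finset.sum_le_sum hterm
    have hrhs : ∑ j ∈ S, (2 * M * x r j ^ 2 + 2 * M * E * |δ j|) = 2 * M * E + 2 * M * E * Dδ := by
      rw [Finset.sum_add_distrib, ← Finset.mul_sum, ← Finset.mul_sum]
    rw [hrhs] at hsum
    have hCgE : Cg * E = 2 * M * E + 2 * M * E * Dδ := by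
      simp only [hCg]
      ring
    rw [hCgE]
    exact hsum
  -- Grönwall: `F(r) = E(r)·exp(-Cg (r - t₀))` is non-increasing on `[t₀, t₁]`
  have hg : ∀ r, HasDerivWithinAt (fun s => Real.exp (-Cg * (s - t₀)))
      (Real.exp (-Cg * (r - t₀)) * -Cg) (Icc t₀ t₁) r := by
    intro r
    simpa using (((hasDerivWithinAt_id r (Icc t₀ t₁)).sub_const t₀).const_mul (-Cg)).exp
  have hF : ∀ r ∈ Icc t₀ t₁, HasDerivWithinAt
      (fun s => (∑ j ∈ S, x s j ^ 2) * Real.exp (-Cg * (s - t₀)))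
      ((∑ j ∈ S, 2 * x r j * truncRHS δ visc r (x r) j) * Real.exp (-Cg * (r - t₀)) +
        (∑ j ∈ S, x r j ^ 2) * (Real.exp (-Cg * (r - t₀)) * -Cg)) (Icc t₀ t₁) r :=
    fun r hr => (hE_deriv r hr).mul (hg r)
  have hanti : AntitoneOn (fun s => (∑ j ∈ S, x s j ^ 2) * Real.exp (-Cg * (s - t₀)))
      (Icc t₀ t₁) := by
    refine antitoneOn_of_hasDerivWithinAt_nonpos (convex_Icc _ _)
      (fun r hr => (hF r hr).continuousWithinAt)
      (fun r hr => (hF r (interior_subset hr)).mono interior_subset) ?_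
    intro r hr
    have hr' : r ∈ Icc t₀ t₁ := interior_subset hr
    have hex := Real.exp_pos (-Cg * (r - t₀))
    have h1 := mul_le_mul_of_nonneg_right (hineq r hr') hex.le
    have h2 : (∑ j ∈ S, 2 * x r j * truncRHS δ visc r (x r) j) * Real.exp (-Cg * (r - t₀)) +
        (∑ j ∈ S, x r j ^ 2) * (Real.exp (-Cg * (r - t₀)) * -Cg) ≤
        Cg * (∑ j ∈ S, x r j ^ 2) * Real.exp (-Cg * (r - t₀)) +
          (∑ j ∈ S, x r j ^ 2) * (Real.exp (-Cg * (r - t₀)) * -Cg) := by linarith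
    refine h2.trans (le_of_eq ?_)
    ring
  -- at `t₀` the energy above the gap vanishes, hence at `t`
  have hE0 : ∑ j ∈ S, x t₀ j ^ 2 = 0 := by
    refine Finset.sum_eq_zero fun j hj => ?_
    obtain ⟨hj1, hj2⟩ := Finset.mem_Ioc.1 hj
    rw [hzero j hj1 hj2]
    ring
  have hFt := hanti ht₀ ht ht.1
  have hFt' : (∑ j ∈ S, x t j ^ 2) * Real.exp (-Cg * (t - t₀)) ≤ 0 := by
    have h0 : (∑ j ∈ S, x t₀ j ^ 2) * Real.exp (-Cg * (t₀ - t₀)) = 0 := by rw [hE0, zero_mul]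
    simpa only [h0] using hFt
  have hEt : ∑ j ∈ S, x t j ^ 2 = 0 := by
    have hex := Real.exp_pos (-Cg * (t - t₀))
    have hle : ∑ j ∈ S, x t j ^ 2 ≤ 0 := by
      by_contra hcon
      have hpos : 0 < ∑ j ∈ S, x t j ^ 2 := lt_of_not_ge hcon
      linarith [mul_pos hpos hex]
    exact le_antisymm hle (hE_nonneg t)
  have hmem : i ∈ S := Finset.mem_Ioc.2 ⟨hi, hiK⟩
  have hsq : x t i ^ 2 = 0 :=
    (Finset.sum_eq_zero_iff_of_nonneg fun j _ => sq_nonneg (x t j)).1 hEt i hmem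
  exact pow_eq_zero_iff (n := 2) two_ne_zero |>.1 hsq

/-- Remark 1.10 for the cut-off viscous system of the tower itself (`δ_k = (N_k/N_{k+1})^{2α}`,
`visc_k = ρ_kνN_k²`, `ν ≥ 0`, any base `N₀ > 0`… — no largeness needed): a forward solution of the
`K`-truncation whose modes `k_* < i ≤ K` vanish at `t₀` keeps them zero; in particular it never
reaches the blow-up profile `x_i = A_i > 0` of `IsTowerSolution.terminal` at those levels, however
the modes `≤ k_*` are prepared. [cite: Palasek2026ElementaryModel, §1.2 Rem. 1.10 (p. 5); §3.3 (truncated_viscous)] -/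
theorem truncated_support_stable_tower {ν α N₀ b β c : ℝ} (hν : 0 ≤ ν) {x : ℝ → ℕ → ℝ}
    {t₀ t₁ : ℝ} {K kstar : ℕ}
    (hode : ∀ k ≤ K, ∀ t ∈ Icc t₀ t₁, HasDerivWithinAt (fun r => x r k)
      (truncRHS (delta N₀ b α) (viscCoeff ν (scale N₀ b) (amp N₀ b β) c) t (x t) k) (Icc t₀ t₁) t)
    (hoff : ∀ t ∈ Icc t₀ t₁, x t (K + 1) = 0) (hzero : ∀ i, kstar < i → i ≤ K → x t₀ i = 0)
    {t : ℝ} (ht : t ∈ Icc t₀ t₁) {i : ℕ} (hi : kstar < i) (hiK : i ≤ K) : x t i = 0 :=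
  truncated_support_stable (fun k s => viscCoeff_nonneg hν (scale N₀ b) (amp N₀ b β) c k s)
    hode hoff hzero ht hi hiK

end Support

/-! ### The datum of the construction: how deep each level is seeded at `t = -T`

The printed initial datum `X(-T) ∈ 𝒞^∞` (p. 10) carries EVERY level: mode `k` is present at
`t = -T` with amplitude `x_k(-T) > 0`, exponentially far below its final value `A_k` for `k ≥ 3`
("because the initial data is so regular, the high modes begin very small", §1.3.2) but not
arbitrarily far — the seed depth `log(A_k/x_k(-T))` is pinned between the frozen ceiling
(sol_bounds)/(z_bound) and the floors (eta_global_bound) resp. the corridor. These are the sizes of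
the seeds that §1.3.1's constraint `X_k^0 ≥ A_k exp(-c N_{k-1}^αA_{k-1}/(N_{k-2}^αA_{k-2}))`
announces heuristically. -/

namespace IsTowerSolution

variable {ν α N₀ b β c : ℝ} {x : ℝ → ℕ → ℝ} (h : IsTowerSolution ν α N₀ b β c x)
include h

/-- `-T ∈ [-T, 0]`: the initial time. [cite: Palasek2026ElementaryModel, §3.1 (tk_times_def)] -/
theorem neg_horizon_mem_Icc : -horizon N₀ b β c ∈ Icc (-horizon N₀ b β c) 0 :=
  ⟨le_rfl, by linarith [h.horizon_pos]⟩

/-- **Seeds are deep (lower bound on the seed depth)**: at the initial time every level `k ≥ 1` sits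
at least `(c/2)A_{k-1}/A_{k-2} - log 2` e-folds below its final amplitude,
`log(A_k/x_k(-T)) ≥ (c/2)A_{k-1}/A_{k-2} - log 2` — the frozen ceiling
`x_k(-T) ≤ 2A_k exp(-(c/2)A_{k-1}/A_{k-2})` of (sol_bounds) read at `t = -T ≤ t_k` (for `k ≥ 3` the
depth is `≥ (c/2)N_{k-2}^{β(b-1)} - log 2 → ∞`: "the high modes begin very small"; for `k = 1, 2` the
truncated index gives the honest small-`k` values `c/2 - log 2` and `(c/2)A₁/A₀ - log 2`).
[cite: Palasek2026ElementaryModel, §3.3 (sol_bounds) with Lemma 3.2 (z_bound); §1.3.2 p. 6; §1.3.1 (X_k^0 constraint) p. 5] -/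
theorem seed_depth_ge {k : ℕ} (hk : 1 ≤ k) :
    c / 2 * (amp N₀ b β (k - 1) / amp N₀ b β (k - 2)) - Real.log 2 ≤
      Real.log (amp N₀ b β k / x (-horizon N₀ b β c) k) := by
  have hT := h.neg_horizon_mem_Icc
  have hfr := h.frozen hk hT (h.neg_horizon_le_tAct k)
  have hx := h.pos k hT
  have hA := h.amp_pos k
  set r := c / 2 * (amp N₀ b β (k - 1) / amp N₀ b β (k - 2)) with hr
  -- `x e^{r} ≤ 2A`, i.e. `e^{r}/2 ≤ A/x`
  have hE := Real.exp_pos r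
  have h1 : x (-horizon N₀ b β c) k * Real.exp r ≤ 2 * amp N₀ b β k := by
    have h2 := mul_le_mul_of_nonneg_right hfr hE.le
    have h3 : 2 * amp N₀ b β k * Real.exp (-r) * Real.exp r = 2 * amp N₀ b β k := by
      rw [mul_assoc, ← Real.exp_add, neg_add_cancel, Real.exp_zero, mul_one]
    rw [h3] at h2
    exact h2
  have h4 : Real.exp (r - Real.log 2) ≤ amp N₀ b β k / x (-horizon N₀ b β c) k := by
    rw [Real.exp_sub, Real.exp_log two_pos, le_div_iff₀ hx]
    linarith
  exact (Real.le_log_iff_exp_le (div_pos hA hx)).2 h4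

/-- **Seeds are not too deep (two-sided seed depth)**: for `k ≥ 2`,
`(c/2)A_{k-1}/A_{k-2} - log 2 ≤ log(A_k/x_k(-T)) ≤ 5A_{k-1}/A_{k-2}` — the level-`k` seed of the printed
datum lies between `(c/2)N_{k-2}^{β(b-1)} - log 2` and `5N_{k-2}^{β(b-1)}` e-folds below `A_k`
(`k ≥ 3`); the upper bound is the trapping floor (eta_global_bound) at `t = -T`.
[cite: Palasek2026ElementaryModel, §3.1 Lemma 3.2 (z_bound), (eta_global_bound); §3.3 (sol_bounds)] -/
theorem seed_depth_bounds {k : ℕ} (hk : 2 ≤ k) :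
    c / 2 * (amp N₀ b β (k - 1) / amp N₀ b β (k - 2)) - Real.log 2 ≤
        Real.log (amp N₀ b β k / x (-horizon N₀ b β c) k) ∧
      Real.log (amp N₀ b β k / x (-horizon N₀ b β c) k) ≤
        5 * (amp N₀ b β (k - 1) / amp N₀ b β (k - 2)) :=
  ⟨h.seed_depth_ge (by omega), h.log_div_le hk h.neg_horizon_mem_Icc⟩

/-- **Seed depth against the lifespan**: for `ν ≥ 0` and `k ≥ 1`, `log(A_k/x_k(-T)) ≤ 2A_{k-1}T =
2cA_{k-1}/A₀` — a seed can be at most as deep as twice the number of host turnovers in the whole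
lifespan (corridor edge `amp_mul_exp_le` at `t = -T`); at the first levels this is the operative
bound (`2cA₁/A₀` for the level-2 seed, `2c` for the level-1 seed: at `c = 1/10` levels 1 and 2 enter
the datum within `e^{0.2}` resp. `e^{0.2A₁/A₀}` of their final amplitudes).
[cite: Palasek2026ElementaryModel, §3 (x_system_nondimensionalized) p. 8, §3.3 (sol_bounds); §3.1 (tk_times_def) T = c/A₀] -/
theorem seed_depth_le_lifespan (hν : 0 ≤ ν) {k : ℕ} (hk : 1 ≤ k) :
    Real.log (amp N₀ b β k / x (-horizon N₀ b β c) k) ≤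
      2 * c * (amp N₀ b β (k - 1) / amp N₀ b β 0) := by
  have h1 := h.log_div_le_two_mul_amp_mul_neg hν hk h.neg_horizon_mem_Icc
  have h2 : 2 * amp N₀ b β (k - 1) * -(-horizon N₀ b β c) =
      2 * c * (amp N₀ b β (k - 1) / amp N₀ b β 0) := by
    rw [neg_neg, horizon]
    ring
  rw [h2] at h1
  exact h1

end IsTowerSolution

/-! ### Where the standing inequalities begin (the scope of `exists_isTowerSolution`)

(exp_small) is "for `N₀` sufficiently large", and the tree's existence statements are correspondingly
`∃ N_*` (`barrierHypotheses_amp`, `exists_isTowerSolution`), the largeness being produced by filters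
(`eventually_S2`, `eventually_V2`, …). Three members of the bundle `BarrierHypotheses` and the viscous
absorption are pure powers of the frequencies and can be read backwards EXACTLY with
`delta_mul_amp_succ_sq_div`: (V2) `12δ₀A₁² ≤ A₀²` iff `N₀^{2(α-β)(b-1)} ≥ 12`; (S2) `8δ_kA_{k+1}² ≤ ½A_k²`
iff `N_k^{2(α-β)(b-1)} ≥ 16`; (V1) `e^{μ₀T} ≤ 3/2` iff `νcN₀^{2-β} ≤ log(3/2)`; and `νN_{k+1}² ≤ ¼A_k` iff
`4ν ≤ N_k^{β-2b}`. The remaining members (S1), (E1), (S4) carry double exponentials and stay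
`eventually` here. `isTowerSolution_of_barrierHypotheses` is the existence theorem with the bundle as
an explicit hypothesis (no `∃ N_*`), so that a concrete base is covered as soon as the displayed
inequalities are checked at it. MODEL bookkeeping only; nothing here is about Navier–Stokes. -/

section Scope

variable {N₀ b β α : ℝ}

/-- Bookkeeping step shared by the two readings below: if `δA₁²/A₀² = P⁻¹` with `A₀, P > 0`,
then `cδA₁² ≤ κA₀²` iff `c ≤ κP`. [cite: Palasek2026ElementaryModel, §3.1 Lemma 3.2 proof, Cases 1–2 (p. 8)] -/
theorem mul_delta_mul_sq_le_iff {δ A₁ A₀ P : ℝ} (c κ : ℝ) (hA : 0 < A₀ ^ 2) (hP : 0 < P)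
    (hr : δ * A₁ ^ 2 / A₀ ^ 2 = P⁻¹) : c * δ * A₁ ^ 2 ≤ κ * A₀ ^ 2 ↔ c ≤ κ * P := by
  have h1 : δ * A₁ ^ 2 = P⁻¹ * A₀ ^ 2 := by rw [← hr, div_mul_cancel₀ _ hA.ne']
  have h3 : c * δ * A₁ ^ 2 = c * P⁻¹ * A₀ ^ 2 := by rw [mul_assoc, h1, ← mul_assoc]
  rw [h3]
  constructor
  · intro h
    have h2 : c * P⁻¹ ≤ κ := le_of_mul_le_mul_right h hA
    rwa [← div_eq_mul_inv, div_le_iff₀ hP] at h2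
  · intro h
    have h2 : c * P⁻¹ ≤ κ := by
      rw [← div_eq_mul_inv, div_le_iff₀ hP]
      exact h
    exact mul_le_mul_of_nonneg_right h2 hA.le

/-- **(V2) read backwards, exactly**: the level-`0` condition `12δ₀A₁² ≤ A₀²` of the tree's bundle
(`BarrierHypotheses.V2`, the constant `1/12` with which Lemma 3.2 Case 1 absorbs the
high-high→low term at the base) holds iff `N₀^{2(α-β)(b-1)} ≥ 12`, by
`δ₀A₁²/A₀² = N₀^{-2(α-β)(b-1)}` (`delta_mul_amp_succ_sq_div`).
[cite: Palasek2026ElementaryModel, §3.1 Lemma 3.2 proof, Cases 1–2 (p. 8): "δ_kA_{k+1}²/A_k² = N_0^{-2(α-β)(b-1)b^k} … can be made small with the choice of N₀"] -/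
theorem twelve_mul_delta_mul_amp_sq_le_iff (hN₀ : 0 < N₀) :
    12 * delta N₀ b α 0 * amp N₀ b β 1 ^ 2 ≤ amp N₀ b β 0 ^ 2 ↔
      12 ≤ N₀ ^ (2 * (α - β) * (b - 1)) := by
  have hA : 0 < amp N₀ b β 0 ^ 2 := pow_pos (amp_pos hN₀ b β 0) 2
  have hpow : 0 < N₀ ^ (2 * (α - β) * (b - 1)) := Real.rpow_pos_of_pos hN₀ _
  have hr := delta_mul_amp_succ_sq_div hN₀ b α β 0
  rw [zero_add, scale_zero, Real.rpow_neg hN₀.le] at hr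
  have h := mul_delta_mul_sq_le_iff 12 1 hA hpow hr
  rwa [one_mul, one_mul] at h

/-- **(S2) read backwards, exactly**: the level-`k` condition `8δ_kA_{k+1}² ≤ ½A_k²` of the tree's
bundle (`BarrierHypotheses.S2`, the constant `1/16` of Lemma 3.2 Case 2 at the top of the next
level) holds iff `N_k^{2(α-β)(b-1)} ≥ 16`.
[cite: Palasek2026ElementaryModel, §3.1 Lemma 3.2 proof, Case 2 (p. 8): "ζ_k(t) ≤ 2A_ke^{½A_{k-1}t} after increasing N₀ if necessary"] -/
theorem eight_mul_delta_mul_amp_sq_le_iff (hN₀ : 0 < N₀) (k : ℕ) :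
    8 * delta N₀ b α k * amp N₀ b β (k + 1) ^ 2 ≤ 1 / 2 * amp N₀ b β k ^ 2 ↔
      16 ≤ scale N₀ b k ^ (2 * (α - β) * (b - 1)) := by
  have hA : 0 < amp N₀ b β k ^ 2 := pow_pos (amp_pos hN₀ b β k) 2
  have hs : 0 < scale N₀ b k := scale_pos hN₀ b k
  have hpow : 0 < scale N₀ b k ^ (2 * (α - β) * (b - 1)) := Real.rpow_pos_of_pos hs _
  have hr := delta_mul_amp_succ_sq_div hN₀ b α β k
  rw [Real.rpow_neg hs.le] at hr
  have h := mul_delta_mul_sq_le_iff 8 (1 / 2) hA hpow hr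
  rw [h]
  constructor <;> intro h' <;> linarith

/-- **Where the standing inequalities begin, level `0`**: every base `N₀` at which the tree's
sufficient conditions for the tower hold (the bundle `BarrierHypotheses` fed to
`exists_regular_solution` / `exists_isTowerSolution`) satisfies `N₀^{2(α-β)(b-1)} ≥ 12` — (exp_small)
"for N₀ sufficiently large" made quantitative for the constant of `.V2`.
[cite: Palasek2026ElementaryModel, §3.1 (exp_small) and Lemma 3.2 proof, Case 1 (p. 8)] -/
theorem BarrierHypotheses.twelve_le_rpow {μ0 c : ℝ} (hN₀ : 0 < N₀)
    (hH : BarrierHypotheses (amp N₀ b β) (delta N₀ b α) μ0 c) :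
    12 ≤ N₀ ^ (2 * (α - β) * (b - 1)) :=
  (twelve_mul_delta_mul_amp_sq_le_iff hN₀).1 hH.V2

/-- **Where the standing inequalities begin, levels `k ≥ 1`**: under the bundle,
`N_k^{2(α-β)(b-1)} ≥ 16` for every `k ≥ 1` (the constant of `.S2`); since `N_k` increases, the
binding instance is `k = 1`, i.e. `N₀^{2(α-β)(b-1)b} ≥ 16` (`sixteen_le_rpow_mul`).
[cite: Palasek2026ElementaryModel, §3.1 (exp_small) and Lemma 3.2 proof, Case 2 (p. 8)] -/
theorem BarrierHypotheses.sixteen_le_scale_rpow {μ0 c : ℝ} (hN₀ : 0 < N₀)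
    (hH : BarrierHypotheses (amp N₀ b β) (delta N₀ b α) μ0 c) {k : ℕ} (hk : 1 ≤ k) :
    16 ≤ scale N₀ b k ^ (2 * (α - β) * (b - 1)) :=
  (eight_mul_delta_mul_amp_sq_le_iff hN₀ k).1 (hH.S2 k hk)

/-- The `k = 1` instance in the base: `N₀^{2(α-β)(b-1)·b} ≥ 16` (`N₁ = N₀^b`). Worked number, MODEL
bookkeeping only: at `(b, β, α) = (11/10, 23/10, 49/20)` the exponent `2(α-β)(b-1)` is `3/100`, so
this reads `N₀^{33/1000} ≥ 16`, i.e. `N₀ ≥ 16^{1000/33} > 10^{36}` (and `.twelve_le_rpow` reads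
`N₀ ≥ 12^{100/3} > 10^{35}`): the tree's existence theorem for the tower is silent below such bases,
where the back-reaction ratio `N_k^{-3/100}` of Lemma 3.2 is of order one (`≈ 0.85` at `N_k = 256`).
[cite: Palasek2026ElementaryModel, §3.1 (exp_small), (nk_choice) N₁ = N₀^b, Lemma 3.2 proof Case 2 (p. 8)] -/
theorem BarrierHypotheses.sixteen_le_rpow_mul {μ0 c : ℝ} (hN₀ : 0 < N₀)
    (hH : BarrierHypotheses (amp N₀ b β) (delta N₀ b α) μ0 c) :
    16 ≤ N₀ ^ (2 * (α - β) * (b - 1) * b) := by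
  have h := hH.sixteen_le_scale_rpow hN₀ le_rfl
  rw [scale, pow_one, ← Real.rpow_mul hN₀.le] at h
  rwa [mul_comm b] at h

/-- **(V1) read backwards, exactly**: the base-mode dissipation condition `exp(μ₀T) ≤ 3/2` of the
tree's bundle (`BarrierHypotheses.V1`, with `μ₀ = νN₀²`, `T = c/A₀ = cN₀^{-β}`: the level-`0`
reservoir loses at most the factor `3/2` over the whole lifespan) holds iff `νcN₀^{2-β} ≤ log(3/2)`.
[cite: Palasek2026ElementaryModel, §3.1 (tk_times_def) T = c/A₀; §3.3 proof of Prop. 3.4 (the mode-0 lower bound x₀ ≥ A₀)] -/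
theorem exp_visc_mul_blowupT_le_iff (hN₀ : 0 < N₀) (ν c : ℝ) :
    Real.exp (ν * N₀ ^ 2 * blowupT (amp N₀ b β) c) ≤ 3 / 2 ↔
      ν * c * N₀ ^ (2 - β) ≤ Real.log (3 / 2) := by
  have h1 : ν * N₀ ^ 2 * blowupT (amp N₀ b β) c = ν * c * N₀ ^ (2 - β) := by
    rw [blowupT, amp_zero, Real.rpow_sub hN₀, Real.rpow_two]
    ring
  rw [h1, ← Real.le_log_iff_exp_le (by norm_num : (0 : ℝ) < 3 / 2)]

/-- **The viscous absorption read backwards, exactly**: the standing inequality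
`νN_{k+1}² ≤ ¼A_k` (the hypothesis `hvisc` of `exists_regular_solution`, from `β > 2b`: "`η_{k-1} -
ρ_kN_k² ≥ ¾A_{k-1} - N_k² ≥ ½A_{k-1}`") holds at level `k` iff `4ν ≤ N_k^{β-2b}` (`N_{k+1} = N_k^b`,
`A_k = N_k^β`). [cite: Palasek2026ElementaryModel, §3.1 (viscous_A_assumptions) β > 2b; §3.3 proof of Prop. 3.4 (p. 10)] -/
theorem visc_absorption_iff (hN₀ : 0 < N₀) (ν : ℝ) (k : ℕ) :
    ν * scale N₀ b (k + 1) ^ 2 ≤ amp N₀ b β k / 4 ↔ 4 * ν ≤ scale N₀ b k ^ (β - 2 * b) := by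
  have hs : 0 < scale N₀ b k := scale_pos hN₀ b k
  have h2b : 0 < scale N₀ b k ^ (2 * b) := Real.rpow_pos_of_pos hs _
  have h1 : scale N₀ b (k + 1) ^ 2 = scale N₀ b k ^ (2 * b) := by
    rw [scale_succ hN₀.le, ← Real.rpow_natCast, ← Real.rpow_mul hs.le]
    norm_num [mul_comm]
  rw [h1, amp, Real.rpow_sub hs, le_div_iff₀ h2b]
  constructor <;> intro h <;> linarith

/-- Along the whole tower: for `N₀ ≥ 1`, `b ≥ 1`, `β ≥ 2b` the absorption hypothesis
`∀ k ≥ 1, νN_k² ≤ ¼A_{k-1}` is equivalent to its base instance `4ν ≤ N₀^{β-2b}` (the scales increase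
and the exponent is non-negative). Worked number, MODEL bookkeeping only: at `(b, β) = (11/10, 23/10)`
the exponent is `β - 2b = 1/10`, so at unit viscosity the tree's absorption hypothesis reads
`N₀ ≥ 4^{10} = 2^{20}`; at `N₀ = 256` the margin `N₀^{1/10} = 2^{4/5} ≈ 1.74` is below `4`, and along
that tower `N_k^{1/10} ≥ 4` first holds at `k = 10`.
[cite: Palasek2026ElementaryModel, §3.1 (viscous_A_assumptions), (nk_choice); §3.3 proof of Prop. 3.4 (p. 10)] -/
theorem forall_visc_absorption_iff (hN₀ : 1 ≤ N₀) (hb : 1 ≤ b) (hβ : 2 * b ≤ β) (ν : ℝ) :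
    (∀ k, 1 ≤ k → ν * scale N₀ b k ^ 2 ≤ amp N₀ b β (k - 1) / 4) ↔ 4 * ν ≤ N₀ ^ (β - 2 * b) := by
  have hN₀' : 0 < N₀ := by linarith
  constructor
  · intro h
    have h1 := (visc_absorption_iff (b := b) (β := β) hN₀' ν 0).1 (by simpa using h 1 le_rfl)
    simpa using h1
  · intro h k hk
    obtain ⟨j, rfl⟩ : ∃ j, k = j + 1 := ⟨k - 1, by omega⟩
    rw [Nat.add_sub_cancel]
    refine (visc_absorption_iff hN₀' ν j).2 (h.trans ?_)
    have hle : N₀ ≤ scale N₀ b j := by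
      unfold scale
      calc N₀ = N₀ ^ (1 : ℝ) := (Real.rpow_one N₀).symm
        _ ≤ N₀ ^ (b ^ j) := Real.rpow_le_rpow_of_exponent_le hN₀ (one_le_pow₀ hb)
    exact Real.rpow_le_rpow hN₀'.le hle (by linarith)

/-- **Existence of the tower under the explicit bundle** (no `∃ N_*`): for `ν ≥ 0`, `N₀ > 1`, `b ≥ 1`,
`β ≥ 0`, if the schedule `A_k = N_k^β`, `δ_k = (N_k/N_{k+1})^{2α}`, `μ₀ = νN₀²`, `c = 1/10` satisfies the
tree's standing inequalities `BarrierHypotheses` and the viscous absorption `νN_k² ≤ ¼A_{k-1}`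
(`k ≥ 1`), then a tower solution with the printed envelope exists at THIS base — Prop. 3.4 for every
truncation order, the `K → ∞` limit and the `C^∞` bootstrap (`exists_regular_solution`). This is the
body of `exists_isTowerSolution` with its largeness hypothesis exposed, so that a concrete
`(N₀, b, β, α)` is covered as soon as the finitely many displayed inequalities are checked there.
[cite: Palasek2026ElementaryModel, §3.3 Prop. 3.4 and proof of Thm 1.3 (p. 10); §3.1 (exp_small), (ratios), (viscous_A_assumptions)] -/
theorem isTowerSolution_of_barrierHypotheses {ν : ℝ} (hν : 0 ≤ ν) (hN₀ : 1 < N₀) (hb : 1 ≤ b)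
    (hβ : 0 ≤ β)
    (hH : BarrierHypotheses (amp N₀ b β) (delta N₀ b α) (ν * N₀ ^ 2) (1 / 10))
    (hvisc : ∀ k, 1 ≤ k → ν * scale N₀ b k ^ 2 ≤ amp N₀ b β (k - 1) / 4) :
    ∃ x : ℝ → ℕ → ℝ, IsTowerSolution ν α N₀ b β (1 / 10) x := by
  have hs0 : scale N₀ b 0 = N₀ := by simp [scale]
  obtain ⟨x, h0, hode, hb0, hbd, h34, hglob, hsm⟩ :=
    exists_regular_solution (ν := ν) (N := scale N₀ b) (A := amp N₀ b β) (δ := delta N₀ b α)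
      (μ0 := ν * N₀ ^ 2) (c := 1 / 10) hH hν (by rw [hs0]) hvisc
  exact ⟨x, hN₀, hb, hβ, by norm_num, h0, hode, hsm, hb0, hbd, h34, hglob⟩

end Scope

end PalasekObukhov

end Literature.Analysis.FluidPDE

end
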